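import Summits.FinalStateConjecture.FinalStateConjecture.Theses.StarvedNecks
import Summits.FinalStateConjecture.FinalStateConjecture.Theses.PhaseMixingCapture
import Summits.FinalStateConjecture.FinalStateConjecture.Theorems.HonestFixedRadiusSettling.Negative.TruncatedMinkowski
import Summits.FinalStateConjecture.FinalStateConjecture.Theorems.WeakCosmicCensorshipMGHD.Negative.TruncatedMinkowski
import Summits.FinalStateConjecture.FinalStateConjecture.Theorems.StarvedNecksHonestFixedRadiusSettlingCert
import Summits.FinalStateConjecture.FinalStateConjecture.Theorems.StarvedNecksHonestFixedRadiusSettlingSurgeryLine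
import Summits.FinalStateConjecture.FinalStateConjecture.Theorems.StarvedNecksHonestFixedRadiusSettlingSurgeryLineGrowing
import Summits.FinalStateConjecture.FinalStateConjecture.Theorems.StarvedNecksHonestFixedRadiusSettlingStubBreathingProbe
import Literature.Geometry.Lorentzian.LeafAdaptedModelChartsMinkowski
import Literature.Geometry.Lorentzian.CausalityPushUp
import Literature.Geometry.Lorentzian.TrivialDataAdmissible
import Literature.Geometry.Lorentzian.CauchyProblemProofs
import Literature.Geometry.Lorentzian.GeodesicProofs
import Literature.Geometry.Lorentzian.LeviCivitaProofs

/-!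
# Disproof attempts on `StarvedNecks.HonestFixedRadiusSettling` (crux stmt-FinalStateConjecture-13550)

Standing adversary file (cdisprove seats `refuter-cdisprove-stmt-FinalStateConjecture-13550-0` = generation 1,
`…-g2-0` = generation 2, `…-g3-0` = generation 3, `…-g4-0` = generation 4; 2026-08-16). Everything below elaborates,
`sorry`-free (axioms propext · Classical.choice · Quot.sound). LANDED negative-side files (tree,
`Theorems/HonestFixedRadiusSettling/Negative/`, namespace `…Theorems.HonestFixedRadiusSettling.Negative`, now
IMPORTED here): `KillShape.lean` (p90218: Set-valued read-back `settlingSet`, kill shape, codimension, WCC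
content), `TruncatedMinkowski.lean` (p108989: the slab `{x⁰ < T}` as a `VacuumCauchyDevelopment` of the trivial
data), `MaximalityLoadBearing.lean` (p111329: its `𝓘⁺` is incomplete; the trivial datum is exceptional without the
guard `𝒟.IsMaximal →`; not yet built on the farm when v5 was written, so §7/§8 below use the sibling crux's
T = 1 truncation `Theorems.WeakCosmicCensorshipMGHD.Negative.truncated`, built, with the same content).
Generation 3 LANDED `CoreLoadBearing.lean` (p116296, commit 73ad206405a1: read-back of the live leaf `stub_core` as
`coreSet`, one atlas certifies `𝓘⁺`, and the ADMISSIBILITY load-bearing table for crux and leaf — vacuum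
constraints LOAD-BEARING (`crux_false_without_constraints`, `core_false_without_constraints`, via the sibling WCC
battery's trapped bump datum), completeness REDUNDANT, second countability REDUNDANT) and proposed
`OneAtlasMaximality.lean` (p116421, deferred until the farm builds its imports: the leaf's maximality guard);
§8 here is their in-file twin.  Generation 4 (line `far-field-surgery` picked by lead c1; open stubs A
`stub_farGluing`, D′ `stub_stableUnfoldingOneAtlas`, D″ `stub_stableUnfoldingGrowing` of skeleton `4a983fe8fc73`)
PROPOSED `StableUnfoldingPoison.lean` (p122095: kill shapes of D′ and D″ — the registered statements negated
verbatim — and the cure principle of D″); §9 here is its in-file twin with the paper verdicts: D″ FALSE ON PAPER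
(poisoned growing far families, modulo Kehle–Unger's extremal-critical-collapse conjectures), D′ SURVIVES
(`sobDev`-smallness load-bearing), A consistent with Mao–Oh–Tao Thm 1.7.  Version 7.

VERDICT (gen 1, gen 2, gen 3, gen 4 — cycle 1 each): NO KILL OF THE CRUX; gen 4 kills (on paper, kernel shape landed)
the lead's NEW third stub D″ `stub_stableUnfoldingGrowing` and confirms D′. The crux is weak cosmic censorship + finite-`N`
sub-extremal Kerr settling, Christodoulou-generically — an open problem; the prelude is honest (no junk model:
`Spacetime` is Hausdorff + second countable, `IsMaximal` is the strong Choquet-Bruhat–Geroch form), the clauses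
are jointly satisfiable (§6, §8d), every physical counterexample needs an MGHD the tree cannot construct, and the
picked line is reduced to ONE registered stub `stub_core` (the open-problem core), whose clauses are again
jointly satisfiable at Minkowski (§8d) and whose maximality guard is again load-bearing (§8c).

## Findings (index)

* §0 `HonestCore`, `HonestFar`, `SettlesHonestly`, `Codim m` — named, verbatim copies of the crux's let-bound
  predicates; `crux_iff_codim_one : HonestFixedRadiusSettling ↔ Codim 1` (by `Iff.rfl`).
* §1 SHAPE OF ANY KILL. `not_isChristodoulouGeneric_iff`: a refutation is an admissible datum `d` failing `P`
  such that EVERY jointly smooth injective admissible curve through `d` has another failing member;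
  `not_crux_of_forall_not`: it suffices that `𝓓 X ≠ ∅` and `P` fails on all of `𝓓 X`. Families are globally
  jointly `C^∞` in `(c, x)` (`IsSmoothDataFamily`); a curve may be modified at distance `1/c` (locally
  eventually constant in `c`), so a counterexample needs a LOCALLY unavoidable defect (e.g. stable naked-singularity
  formation) — none is constructible in the tree (no MGHD of any admissible datum is constructed; MGHD existence
  itself is the named fact `choquetBruhat_geroch_exists_mghd_cauchy`).
* §2 LOAD-BEARING: the codimension parameter. `codim_zero : Codim 0` holds for free (constant families), so the
  `1` is the whole content; `codim_one_of_succ : Codim (m+1) → Codim 1`: the crux is the WEAKEST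
  positive-codimension version (Christodoulou's scalar-field instability theorem is codimension 2).
* §3 THE CRUX CONTAINS WEAK COSMIC CENSORSHIP (+ generic MGHD existence): `wcc_of_crux`, `crux_false_of_not_wcc`.
* §4 VACUITY CHECKS. `codim_clause_of_eq_empty` (no admissible data ⇒ vacuous; harmless, `X = E3` is admissible);
  `honestCore_mono` / `honestFar_mono` (monotone in `R₀`); `honestCore_iff_of_N_eq_zero`,
  `honestFar_iff_of_N_eq_zero` (dispersive case).
* §6 CONSISTENCY WITNESS (Lean): `settlesAt_minkowski` — at the Minkowski development `𝒟₀` of the trivial data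
  EVERY clause of `P` holds (complete `𝓘⁺`; the identity flat chart is an honest `N = 0` decomposition `d₀` of
  `O₀ = {x⁰ ≥ 0} = J⁺(Σ) ∩ I⁻({x⁰ > 1})`); `not_crux_of_forall_not_slice`.
* §7 MAXIMALITY IS LOAD-BEARING (gen 2; kernel-checked here since v5, over the landed Negative files):
  `not_settlesAt_truncated` — the time-truncated Minkowski development fails `SettlesAt` (incomplete `𝓘⁺`);
  `settlesHonestly_false_without_isMaximal` — `P` with the guard `𝒟.IsMaximal →` deleted FAILS at the admissible
  trivial datum; `codimWithoutIsMaximal_zero` (still free at codimension 0), `crux_of_codimWithoutIsMaximal_one`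
  (the unguarded crux is stronger), `codimWithoutIsMaximal_one_obligation` (what it would demand at the trivial
  datum: an admissible curve all of whose other members have ONLY complete-`𝓘⁺` developments — absurd on paper by
  time truncation; not refutable in a tree that constructs no development of a non-trivial datum, which is also
  why no crux-LEVEL `_false_without_` theorem can be kernel-checked: §1's kill shape needs failure on a whole
  admissible class).
* §8 GENERATION 3 (2026-08-16T16–18Z): THE LIVE LEAF `stub_core`. The lead's reshape v2 left ONE registered stub,
  `stub_core : KerrEndedHonestSettlingGeneric` (generic: MGHD + honest `C⁴` decomposition + ONE ATLAS AT INFINITY,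
  no `𝓘⁺` clause), and LANDED the reduction `Theorems.StarvedNecks.OneOverDelta.honestFixedRadiusSettling_of_core`
  with the certificate `hasCompleteNullInfinity_of_oneAtlas` (CERT). Kernel-checked here:
  (a) READ-BACK: `Core.OneAtlas`, `Core.CoreAt`, `Core.CoreSettles`, `Core.CoreCodim m`;
  `Core.crux_of_coreCodim_one : CoreCodim 1 → HonestFixedRadiusSettling` is the landed reduction applied
  verbatim, so `CoreCodim 1` IS the registered stub up to unfolding, and `Core.not_coreCodim_one_of_not_crux`:
  ANY REFUTATION OF THE CRUX REFUTES THE LEAF (it is at least as strong); `Core.settlesAt_of_coreAt` (`Q ⇒ P`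
  pointwise at a development, by CERT); `Core.coreCodim_zero` (codimension 0 free).
  (b) THE ONE-ATLAS CLAUSES EXCLUDE TIME TRUNCATION: `Core.not_oneAtlas_truncated` — on the truncated Minkowski
  development NO `Cᵏ` (`k ≥ 1`) decomposition of any region satisfies the seventeen clauses (CERT ∘ incomplete
  `𝓘⁺`); `Core.not_coreAt_truncated`.
  (c) THE LEAF'S MAXIMALITY GUARD IS LOAD-BEARING: `Core.coreSettles_false_without_isMaximal` (trivial datum
  exceptional for the unguarded `Q`), `Core.coreCodimWithoutIsMaximal_one_obligation`.
  (d) CONSISTENCY WITNESS FOR THE LEAF: `Core.coreAt_minkowski : CoreAt 𝒟₀` — all clauses of `Q`'s universal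
  conjunct hold at the Minkowski development (identity flat chart, `M = a = 0`, `φ` the inclusion
  `Kerr.slice 0 0 ↪ Minkowski.slice`, `R♯ ≡ 1`, core = closed 2-ball, `κ = 1`; the crux-plan's sanity lemma,
  re-proved inside this file), so — exactly as for `P` — `Q(trivialData)` can only fail through `IsMaximal`, and
  no refutation of the leaf can come from its clauses alone.
  (e) PAPER FINDINGS (docstring of §8e): the admissible class has ZERO ADM LINEAR MOMENTUM (`k = o₁(r⁻²)`), so the
  leaf's UNBOOSTED exact Kerr end is the only admissible Kerr end anyway (boosted Kerr slices have `k ≍ P/r²`),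
  Corvino–Schoen 10-charge matching (generically a boosted end) is useless for witness curves, and the
  admissibility-preserving surgery is obstruction-free gluing onto a rest-frame Kerr end with a positive mass
  gap (Mao–Oh–Tao Thm 1.10, `ΔE > |ΔP| = 0`); exact Kerr BL-slice ends ARE DR-admissible (`h = (1+2M/r)δ + O(r⁻²)`
  after the isotropic radial change, `k ≍ aM/r³ = o₁(r⁻²)`); the exceptional set of `Q` contains every
  non-Kerr-ended admissible datum (e.g. the Minkowski slice `x⁰ = log log(e+|x⃗|)`), no obstruction to
  genericity; and WHY NO `_false_without_scri` / `_false_without_oneAtlas` SMALL MODEL EXISTS: every Cauchy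
  sub-development of Minkowski through `{x⁰ = 0}` is `E ∖ (W⁺ ∪ W⁻)` with `W⁺` a closed future set, and if
  `W⁺ ≠ ∅` it carries NO `N = 0` decomposition with `C¹`-deviation `→ 0` at all (ceiling argument), while if
  `W⁺ = ∅` its `𝓘⁺` is complete — inside Minkowski the decomposition clause already forces complete `𝓘⁺`.
* §9 GENERATION 4 (2026-08-16T19Z): LINE `far-field-surgery` (picked by lead c1). (a) READ-BACK of the three registered
  stubs as named propositions `Surgery.FarGluing` (A), `Surgery.StableUnfoldingOneAtlas` (D′),
  `Surgery.StableUnfoldingGrowing` (D″) and of 15427-per-datum `Surgery.FarAnnulusGluingAt` (A″); the two tree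
  reductions apply verbatim (`Surgery.crux_of_surgery`, `Surgery.crux_of_growing`), hence
  `Surgery.not_A_or_not_D'_of_not_crux`, `Surgery.not_A''_or_not_D''_of_not_crux`. (b) THE KILL SHAPE OF D″
  (`Surgery.stableUnfoldingGrowing_false_of_poison`, `Surgery.cure_of_stableUnfoldingGrowing`; landed twin p122095):
  ONE poisoned growing far-gluing family refutes D″; D″ ⇔ "every growing far family is cured by ONE fixed interior
  re-filling" — FALSE ON PAPER for small `η` (a Kehle–Unger extremal wall swept across the radius inside the
  unconstrained annulus `{R < ‖x‖ < 32R}`, under a dispersing Mao–Oh–Tao glue shell), while for `η > 64` the throat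
  `‖x‖ = m R/2 > 32R` shields everything and D″ is SwallowTheDatum's burial with probe and threshold idle —
  kernel-checked as `Surgery.stableUnfoldingGrowing64_of_burial : Burial → StableUnfoldingGrowing64` (constant threshold,
  landed breathing probe; landed twin p122410); so `FarAnnulusGluing ∧ D″` is false on paper, its only true regime is
  burial, and 15427's atom cannot serve this line. (c) THE SAME SHAPE FOR D′
  (`Surgery.stableUnfoldingOneAtlas_false_of_poison`) is expected EMPTY: `sobDev`-smallness is subcritical
  (a plant of mass `μ` at scale `ρ₀ ≲ μ` costs `R μ²/ρ₀³ ≳ R/μ → ∞`), hence LOAD-BEARING for D′. (d) PAPER (§9d):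
  Mao–Oh–Tao Thm 1.7's (1.17)–(1.21) check out for A at scale `R`; the one-atlas clauses hold on Schwarzschild-ended
  members with `Rs` = the outgoing null cone from `32R′` and `Bs` = the closed ball of radius `32R′ + 1` (answer to
  the lead's `disprover-wanted`); load-bearing table of D′ (`t ≠ 0` yes, `|t| < 1` normalisation, `ρ` bounded near
  `0` false, `Tendsto m` harmless).
* §5 NEAR-MISSES / WHY IT RESISTS (docstrings only): junk models none; universal failure impossible (§6, §8d);
  two-hole chart topology not misstated (tilted leaves); physical failure modes (¬WCC open set, generic extremal
  limits, `N = ∞` cascades, non-Kerr stationary end states) not constructible.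
-/

noncomputable section

set_option linter.dupNamespace false

open Literature.Geometry.Lorentzian
open scoped Manifold ContDiff ENNReal Topology
open Filter Set

namespace Summit.FinalStateConjecture.FinalStateConjecture.Cruxes.HonestFixedRadiusSettling.Disproof

open Summit.FinalStateConjecture.FinalStateConjecture.Theses.StarvedNecks (HonestFixedRadiusSettling)

/-! ### §0 Named copies of the crux's predicates -/

/-- `HonestCore d R₀` — verbatim the let-bound `Hc` of the crux: sub-extremal holes with
`100 Mᵢ ≤ R₀` and orthochronous boosts (C1); anchoring at every radius `≥ R₀` (C2); relative
closedness of late tube portions for every continuous radius profile (C3); future-oriented flat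
chart (C4). -/
def HonestCore (𝓢 : Spacetime.{0} 4) (O : Set 𝓢.carrier) (k : ℕ) (d : FinalStateDecomposition 𝓢 O k)
    (R₀ : ℝ) : Prop :=
  let B := d.background; let t := fun i ↦ (B i).time; let r := fun i ↦ (B i).radius; let Ψ := d.chart;
  (∀ i, Kerr.IsSubextremal (d.mass i) (d.spin i) ∧ 100 * d.mass i ≤ R₀ ∧
      0 < ((d.motion i).1 : E4 ≃L[ℝ] E4) (E4.basisVector 0) 0) ∧
  (∀ i (ϱ τ₂ : ℝ), R₀ ≤ ϱ → d.τ₀ < τ₂ →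
      Ψ i '' {x | d.τ₀ < t i x.1 ∧ t i x.1 < τ₂ ∧ r i x.1 < ϱ} ⊆
        𝓢.metric.causalPast 𝓢.timeOrientation (Ψ i '' (B i).truncTimeSlab ϱ τ₂)) ∧
  (∀ i (τ' : ℝ) (ϱ : ℝ → ℝ), Continuous ϱ → d.τ₀ < τ' →
      let A := Ψ i '' {x | τ' ≤ t i x.1 ∧ r i x.1 ≤ ϱ (t i x.1)}; closure A ∩ O ⊆ A) ∧
  (∀ y : d.flatDomain, d.τ₀ < y.1 0 →
      𝓢.timeOrientation.IsFutureDirected (mfderiv 𝓘(ℝ, E4) (𝓡 4) d.flatChart y (E4.basisVector 0)))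

/-- `HonestFar d R₀` — verbatim the let-bound `Hf` of the crux: flat-late points below later flat
slabs (F1); closures of far flat slabs are flat points (F2); each hole chart eventually
`C⁰`-close (`1/(10‖Λᵢ‖²)`) to its boosted Kerr on its own Voronoi cell beyond `R₀` (F3). -/
def HonestFar (𝓢 : Spacetime.{0} 4) (O : Set 𝓢.carrier) (k : ℕ) (d : FinalStateDecomposition 𝓢 O k)
    (R₀ : ℝ) : Prop :=
  let B := d.background; let t := fun i ↦ (B i).time; let r := fun i ↦ (B i).radius; let Φ := d.flatChart;
  (∀ τ₂ : ℝ, d.τ₀ < τ₂ → Φ '' {y | d.τ₀ < y.1 0 ∧ y.1 0 < τ₂} ⊆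
      𝓢.metric.causalPast 𝓢.timeOrientation (Φ '' (Minkowski.backgroundOn d.flatDomain).timeSlab τ₂)) ∧
  (∀ τ' : ℝ, d.τ₀ < τ' →
      closure (Φ '' {y | τ' ≤ y.1 0 ∧ ∀ i, d.excision i (y.1 0) + 1 ≤ r i y.1}) ⊆ Φ '' {y | τ' ≤ y.1 0}) ∧
  (∀ i, ∃ T : ℝ, supCkENorm (Subtype.val '' {x : (B i).domain | T ≤ t i x.1 ∧ R₀ ≤ r i x.1 ∧
      ∀ j, j ≠ i → r i x.1 ≤ r j x.1}) 0 (𝓢.deviationExtend (B i) (d.chart i)) ≤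
        ENNReal.ofReal (1 / (10 * ‖(((d.motion i).1 : E4 ≃L[ℝ] E4) : E4 →L[ℝ] E4)‖ ^ 2)))

section Pointwise

variable {X : Type} [TopologicalSpace X] [ChartedSpace E3 X] [IsManifold (𝓡 3) ∞ X] [ConnectedSpace X]

/-- The pointwise property `P D` whose Christodoulou-genericity the crux asserts. -/
def SettlesHonestly (D : InitialDataSet (𝓡 3) X) : Prop :=
  (∃ 𝒟 : VacuumCauchyDevelopment D, 𝒟.IsMaximal) ∧
    ∀ 𝒟 : VacuumCauchyDevelopment D, 𝒟.IsMaximal →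
      HasCompleteNullInfinity 𝒟.toCauchyDevelopment ∧
        ∃ (O : Set 𝒟.carrier) (d : FinalStateDecomposition 𝒟.toSpacetime O 4) (R₀ : ℝ),
          O = exteriorOf 𝒟.toCauchyDevelopment d.charted ∧
            HonestCore 𝒟.toSpacetime O 4 d R₀ ∧ HonestFar 𝒟.toSpacetime O 4 d R₀

/-- The WCC part of `P`: an MGHD exists and every MGHD has complete `𝓘⁺`. -/
def CensoredMGHD (D : InitialDataSet (𝓡 3) X) : Prop :=
  (∃ 𝒟 : VacuumCauchyDevelopment D, 𝒟.IsMaximal) ∧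
    ∀ 𝒟 : VacuumCauchyDevelopment D, 𝒟.IsMaximal → HasCompleteNullInfinity 𝒟.toCauchyDevelopment

omit [TopologicalSpace X] [ChartedSpace E3 X] [IsManifold (𝓡 3) ∞ X] [ConnectedSpace X] in
/-- `P` implies the WCC part pointwise. -/
theorem censoredMGHD_of_settlesHonestly [TopologicalSpace X] [ChartedSpace E3 X]
    [IsManifold (𝓡 3) ∞ X] [ConnectedSpace X] {D : InitialDataSet (𝓡 3) X}
    (h : SettlesHonestly D) : CensoredMGHD D :=
  ⟨h.1, fun 𝒟 h𝒟 ↦ (h.2 𝒟 h𝒟).1⟩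

end Pointwise

/-- The crux with the codimension as a parameter. -/
def Codim (m : ℕ) : Prop :=
  ∀ (X : Type) [TopologicalSpace X] [ChartedSpace E3 X] [IsManifold (𝓡 3) ∞ X] [T2Space X]
    [SecondCountableTopology X] [ConnectedSpace X],
    InitialDataSet.IsChristodoulouGeneric (admissibleVacuumData X) SettlesHonestly m

/-- The crux is `Codim 1`, definitionally (the let-bound predicates zeta-reduce to the named ones). -/
theorem crux_iff_codim_one : HonestFixedRadiusSettling ↔ Codim 1 := Iff.rfl

/-! ### §1 Shape of any kill -/

section Genericity

variable {E : Type*} [NormedAddCommGroup E] [NormedSpace ℝ E] {H : Type*} [TopologicalSpace H]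
  {I : ModelWithCorners ℝ E H} {Y : Type*} [TopologicalSpace Y] [ChartedSpace H Y]
  [IsManifold I ∞ Y]

/-- Unfolding: failure of Christodoulou genericity is an exceptional datum through which every
smooth injective admissible `m`-parameter family has another exceptional member. -/
theorem not_isChristodoulouGeneric_iff (𝓓 : Set (InitialDataSet I Y)) (P : InitialDataSet I Y → Prop)
    (m : ℕ) :
    ¬ InitialDataSet.IsChristodoulouGeneric 𝓓 P m ↔
      ∃ d ∈ 𝓓, ¬ P d ∧ ∀ F : EuclideanSpace ℝ (Fin m) → InitialDataSet I Y,
        InitialDataSet.IsSmoothDataFamily m F → F 0 = d → Function.Injective F → (∀ c, F c ∈ 𝓓) →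
          ∃ c ≠ 0, ¬ P (F c) := by
  constructor
  · intro h
    by_contra hcon
    apply h
    intro d hd
    by_contra hF
    apply hcon
    refine ⟨d, hd.1, hd.2, fun F hF0 h0 hinj hmem ↦ ?_⟩
    by_contra hc
    push Not at hc
    exact hF ⟨F, hF0, h0, hinj, hmem, fun c hc' hE ↦ hE.2 (hc c hc')⟩
  · rintro ⟨d, hd, hP, h⟩ hgen
    obtain ⟨F, hF, h0, hinj, hmem, hE⟩ := hgen d ⟨hd, hP⟩
    obtain ⟨c, hc, hPc⟩ := h F hF h0 hinj hmem
    exact hE c hc ⟨hmem c, hPc⟩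

/-- A nonzero parameter exists as soon as `0 < m`. -/
theorem exists_ne_zero_euclideanSpace {m : ℕ} (hm : 0 < m) : ∃ c : EuclideanSpace ℝ (Fin m), c ≠ 0 := by
  refine ⟨EuclideanSpace.single ⟨0, hm⟩ 1, fun h ↦ ?_⟩
  have := congrArg (fun v : EuclideanSpace ℝ (Fin m) ↦ v ⟨0, hm⟩) h
  simp at this

/-- Sufficient kill shape: a nonempty admissible class on which `P` fails everywhere refutes
genericity in every positive codimension. -/
theorem not_isChristodoulouGeneric_of_forall_not {𝓓 : Set (InitialDataSet I Y)}
    {P : InitialDataSet I Y → Prop} {m : ℕ} (hm : 0 < m) (hne : 𝓓.Nonempty)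
    (h : ∀ d ∈ 𝓓, ¬ P d) : ¬ InitialDataSet.IsChristodoulouGeneric 𝓓 P m := by
  intro hgen
  obtain ⟨d, hd⟩ := hne
  obtain ⟨F, -, -, -, hmem, hE⟩ := hgen d ⟨hd, h d hd⟩
  obtain ⟨c, hc⟩ := exists_ne_zero_euclideanSpace hm
  exact hE c hc ⟨hmem c, h _ (hmem c)⟩

/-- Vacuity: an empty admissible class makes every property generic. -/
theorem isChristodoulouGeneric_of_eq_empty {𝓓 : Set (InitialDataSet I Y)} (h𝓓 : 𝓓 = ∅)
    (P : InitialDataSet I Y → Prop) (m : ℕ) : InitialDataSet.IsChristodoulouGeneric 𝓓 P m := by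
  intro d hd
  rw [h𝓓] at hd
  exact absurd hd.1 (Set.notMem_empty d)

/-- Codimension `0` is free for every property (constant family; the relative version of
`InitialDataSet.hasCodimAtLeast_zero`). -/
theorem isChristodoulouGeneric_zero (𝓓 : Set (InitialDataSet I Y)) (P : InitialDataSet I Y → Prop) :
    InitialDataSet.IsChristodoulouGeneric 𝓓 P 0 := by
  intro d hd
  refine ⟨fun _ ↦ d, InitialDataSet.isSmoothDataFamily_const 0 d, rfl, ?_, fun _ ↦ hd.1, ?_⟩
  · intro a b _
    exact Subsingleton.elim a b
  · intro c hc
    exact absurd (Subsingleton.elim c 0) hc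

/-- Genericity is monotone in the property (antitone in the exceptional set). -/
theorem isChristodoulouGeneric_mono {𝓓 : Set (InitialDataSet I Y)} {P Q : InitialDataSet I Y → Prop}
    (hPQ : ∀ d ∈ 𝓓, P d → Q d) {m : ℕ} (hP : InitialDataSet.IsChristodoulouGeneric 𝓓 P m) :
    InitialDataSet.IsChristodoulouGeneric 𝓓 Q m := by
  intro d hd
  obtain ⟨F, hF, h0, hinj, hmem, hE⟩ := hP d ⟨hd.1, fun h ↦ hd.2 (hPQ d hd.1 h)⟩
  exact ⟨F, hF, h0, hinj, hmem, fun c hc hc' ↦ hE c hc ⟨hc'.1, fun h ↦ hc'.2 (hPQ _ hc'.1 h)⟩⟩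

end Genericity

/-- KILL SHAPE for the crux: one `X` with a nonempty admissible class on which `SettlesHonestly`
fails identically. (Unreachable in the tree: `SettlesHonestly` of trivial data is expected TRUE.) -/
theorem not_crux_of_forall_not (X : Type) [TopologicalSpace X] [ChartedSpace E3 X]
    [IsManifold (𝓡 3) ∞ X] [T2Space X] [SecondCountableTopology X] [ConnectedSpace X]
    (hne : (admissibleVacuumData X).Nonempty)
    (h : ∀ D ∈ admissibleVacuumData X, ¬ SettlesHonestly D) : ¬ HonestFixedRadiusSettling :=
  fun hS ↦ not_isChristodoulouGeneric_of_forall_not one_pos hne h (hS X)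

/-! ### §2 The codimension parameter is load-bearing -/

/-- `Codim 0` holds outright: the `1` in the crux is its whole content. -/
theorem codim_zero : Codim 0 := fun X _ _ _ _ _ _ ↦
  isChristodoulouGeneric_zero (admissibleVacuumData X) SettlesHonestly


section CodimMono

variable {E : Type*} [NormedAddCommGroup E] [NormedSpace ℝ E] {H : Type*} [TopologicalSpace H]
  {I : ModelWithCorners ℝ E H} {Y : Type*} [TopologicalSpace Y] [ChartedSpace H Y]
  [IsManifold I ∞ Y]

/-- The coordinate-axis embedding `ℝ¹ → ℝᵐ⁺¹`, `c ↦ c₀ e₀`. -/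
def axisEmbed (m : ℕ) : EuclideanSpace ℝ (Fin 1) →L[ℝ] EuclideanSpace ℝ (Fin (m + 1)) :=
  ContinuousLinearMap.smulRight (EuclideanSpace.proj (0 : Fin 1))
    (EuclideanSpace.single (0 : Fin (m + 1)) (1 : ℝ))

/-- `axisEmbed m c = c₀ • e₀`. -/
theorem axisEmbed_apply (m : ℕ) (c : EuclideanSpace ℝ (Fin 1)) :
    axisEmbed m c = (c 0) • EuclideanSpace.single (0 : Fin (m + 1)) (1 : ℝ) := rfl

/-- `axisEmbed m c = 0 ↔ c = 0`. -/
theorem axisEmbed_eq_zero_iff (m : ℕ) (c : EuclideanSpace ℝ (Fin 1)) : axisEmbed m c = 0 ↔ c = 0 := by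
  constructor
  · intro h
    have h0 := congrArg (fun v : EuclideanSpace ℝ (Fin (m + 1)) ↦ v 0) h
    simp [axisEmbed_apply] at h0
    ext i
    have hi : i = 0 := Subsingleton.elim i 0
    subst hi
    simpa using h0
  · rintro rfl
    exact map_zero _

/-- `axisEmbed m` is injective. -/
theorem axisEmbed_injective (m : ℕ) : Function.Injective (axisEmbed m) := by
  intro a b h
  have : axisEmbed m (a - b) = 0 := by rw [map_sub, h, sub_self]
  exact sub_eq_zero.mp ((axisEmbed_eq_zero_iff m _).mp this)

/-- **Codimension is monotone**: a set of codimension `≥ m + 1` inside `𝓓` has codimension `≥ 1`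
(restrict the family to a coordinate axis). -/
theorem hasCodimAtLeastIn_one_of_succ {𝓓 𝓔 : Set (InitialDataSet I Y)} {m : ℕ}
    (h : InitialDataSet.HasCodimAtLeastIn 𝓓 𝓔 (m + 1)) : InitialDataSet.HasCodimAtLeastIn 𝓓 𝓔 1 := by
  intro d hd
  obtain ⟨F, hF, h0, hinj, hmem, hE⟩ := h d hd
  have hι : ContMDiff (𝓘(ℝ, EuclideanSpace ℝ (Fin 1)).prod I) (𝓘(ℝ, EuclideanSpace ℝ (Fin (m + 1))).prod I)
      ∞ (fun p : EuclideanSpace ℝ (Fin 1) × Y ↦ (axisEmbed m p.1, p.2)) :=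
    ((axisEmbed m).contMDiff.comp contMDiff_fst).prodMk contMDiff_snd
  refine ⟨fun c ↦ F (axisEmbed m c), ⟨hF.1.comp hι, hF.2.comp hι⟩, ?_, ?_, fun c ↦ hmem _, ?_⟩
  · show F (axisEmbed m 0) = d
    rw [map_zero, h0]
  · exact hinj.comp (axisEmbed_injective m)
  · intro c hc
    exact hE _ (fun h ↦ hc ((axisEmbed_eq_zero_iff m c).mp h))

/-- Christodoulou genericity with codimension `m + 1` implies it with codimension `1`. -/
theorem isChristodoulouGeneric_one_of_succ {𝓓 : Set (InitialDataSet I Y)} {P : InitialDataSet I Y → Prop}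
    {m : ℕ} (h : InitialDataSet.IsChristodoulouGeneric 𝓓 P (m + 1)) :
    InitialDataSet.IsChristodoulouGeneric 𝓓 P 1 :=
  hasCodimAtLeastIn_one_of_succ h

end CodimMono

/-- `Codim (m+1) → Codim 1`: the crux is the weakest positive-codimension version. -/
theorem codim_one_of_succ {m : ℕ} (h : Codim (m + 1)) : Codim 1 := fun X _ _ _ _ _ _ ↦
  isChristodoulouGeneric_one_of_succ (h X)

/-! ### §3 The crux contains weak cosmic censorship -/

/-- The crux implies the typed weak cosmic censorship item of route PhaseMixingCapture
(`stmt-FinalStateConjecture-9952`, generic MGHD existence + complete `𝓘⁺`), by monotonicity of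
genericity. -/
theorem wcc_of_crux (h : HonestFixedRadiusSettling) :
    Summit.FinalStateConjecture.FinalStateConjecture.Theses.PhaseMixingCapture.WeakCosmicCensorshipMGHD := by
  intro X _ _ _ _ _ _
  exact isChristodoulouGeneric_mono (fun D _ hD ↦ censoredMGHD_of_settlesHonestly hD) (h X)

/-- NEGATIVE LEMMA modulo ¬WCC: any disproof of Christodoulou weak cosmic censorship (sojourn form,
over `VacuumCauchyDevelopment`) kills the crux. -/
theorem crux_false_of_not_wcc
    (h : ¬ Summit.FinalStateConjecture.FinalStateConjecture.Theses.PhaseMixingCapture.WeakCosmicCensorshipMGHD) :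
    ¬ HonestFixedRadiusSettling :=
  fun hS ↦ h (wcc_of_crux hS)

/-! ### §4 Vacuity and monotonicity checks on the honesty predicates -/

/-- On an `X` without admissible data the clause of the crux is vacuous. -/
theorem codim_clause_of_eq_empty (X : Type) [TopologicalSpace X] [ChartedSpace E3 X]
    [IsManifold (𝓡 3) ∞ X] [T2Space X] [SecondCountableTopology X] [ConnectedSpace X]
    (h : admissibleVacuumData X = ∅) (m : ℕ) :
    InitialDataSet.IsChristodoulouGeneric (admissibleVacuumData X) SettlesHonestly m :=
  isChristodoulouGeneric_of_eq_empty h _ m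

section Honesty

variable {𝓢 : Spacetime.{0} 4} {O : Set 𝓢.carrier} {k : ℕ}

/-- `HonestCore` is monotone in `R₀` (C1: `100M ≤ R₀ ≤ R₀'`; C2: fewer radii; C3, C4 untouched). -/
theorem honestCore_mono (d : FinalStateDecomposition 𝓢 O k) {R₀ R₀' : ℝ} (hR : R₀ ≤ R₀')
    (h : HonestCore 𝓢 O k d R₀) : HonestCore 𝓢 O k d R₀' := by
  obtain ⟨h1, h2, h3, h4⟩ := h
  refine ⟨fun i ↦ ⟨(h1 i).1, (h1 i).2.1.trans hR, (h1 i).2.2⟩, fun i ϱ τ₂ hϱ hτ ↦ h2 i ϱ τ₂ (hR.trans hϱ) hτ,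
    h3, h4⟩

/-- `HonestFar` is monotone in `R₀` (F3 is a sup over a smaller set). -/
theorem honestFar_mono (d : FinalStateDecomposition 𝓢 O k) {R₀ R₀' : ℝ} (hR : R₀ ≤ R₀')
    (h : HonestFar 𝓢 O k d R₀) : HonestFar 𝓢 O k d R₀' := by
  obtain ⟨h1, h2, h3⟩ := h
  refine ⟨h1, h2, fun i ↦ ?_⟩
  obtain ⟨T, hT⟩ := h3 i
  refine ⟨T, le_trans (supCkENorm_mono (Set.image_mono ?_) _ _) hT⟩
  intro x hx
  exact ⟨hx.1, hR.trans hx.2.1, hx.2.2⟩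

/-- Dispersive case: with no hole, `HonestCore` is just the future-orientation of the flat chart. -/
theorem honestCore_iff_of_N_eq_zero (d : FinalStateDecomposition 𝓢 O k) (hN : d.N = 0) (R₀ : ℝ) :
    HonestCore 𝓢 O k d R₀ ↔
      ∀ y : d.flatDomain, d.τ₀ < y.1 0 →
        𝓢.timeOrientation.IsFutureDirected (mfderiv 𝓘(ℝ, E4) (𝓡 4) d.flatChart y (E4.basisVector 0)) := by
  haveI : IsEmpty (Fin d.N) := hN ▸ Fin.isEmpty'
  simp only [HonestCore, IsEmpty.forall_iff, true_and]

/-- Dispersive case: with no hole, `HonestFar` is F1 plus closedness of the late flat slabs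
`Φ({τ' ≤ x⁰})`, and it no longer depends on `R₀`. -/
theorem honestFar_iff_of_N_eq_zero (d : FinalStateDecomposition 𝓢 O k) (hN : d.N = 0) (R₀ : ℝ) :
    HonestFar 𝓢 O k d R₀ ↔
      (∀ τ₂ : ℝ, d.τ₀ < τ₂ → d.flatChart '' {y | d.τ₀ < y.1 0 ∧ y.1 0 < τ₂} ⊆
          𝓢.metric.causalPast 𝓢.timeOrientation
            (d.flatChart '' (Minkowski.backgroundOn d.flatDomain).timeSlab τ₂)) ∧
        ∀ τ' : ℝ, d.τ₀ < τ' →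
          closure (d.flatChart '' {y | τ' ≤ y.1 0}) ⊆ d.flatChart '' {y | τ' ≤ y.1 0} := by
  haveI : IsEmpty (Fin d.N) := hN ▸ Fin.isEmpty'
  simp only [HonestFar, IsEmpty.forall_iff, and_true]

end Honesty

/-! ### §6 Consistency witness: Minkowski space satisfies every clause of `P` at its own
Cauchy development (the universal-failure kill route is closed, modulo maximality) -/

section MinkowskiWitness

open Minkowski TopologicalSpace

/-- `P` split at a development: complete `𝓘⁺` and an honest fixed-radius decomposition of the
self-determined exterior. `SettlesHonestly D ↔ (∃ MGHD) ∧ ∀ MGHD 𝒟, SettlesAt 𝒟` (`Iff.rfl`). -/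
def SettlesAt {X : Type} [TopologicalSpace X] [ChartedSpace E3 X] [IsManifold (𝓡 3) ∞ X]
    [ConnectedSpace X] {D : InitialDataSet (𝓡 3) X} (𝒟 : VacuumCauchyDevelopment D) : Prop :=
  HasCompleteNullInfinity 𝒟.toCauchyDevelopment ∧
    ∃ (O : Set 𝒟.carrier) (d : FinalStateDecomposition 𝒟.toSpacetime O 4) (R₀ : ℝ),
      O = exteriorOf 𝒟.toCauchyDevelopment d.charted ∧
        HonestCore 𝒟.toSpacetime O 4 d R₀ ∧ HonestFar 𝒟.toSpacetime O 4 d R₀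

theorem settlesHonestly_iff {X : Type} [TopologicalSpace X] [ChartedSpace E3 X] [IsManifold (𝓡 3) ∞ X]
    [ConnectedSpace X] (D : InitialDataSet (𝓡 3) X) :
    SettlesHonestly D ↔ (∃ 𝒟 : VacuumCauchyDevelopment D, 𝒟.IsMaximal) ∧
      ∀ 𝒟 : VacuumCauchyDevelopment D, 𝒟.IsMaximal → SettlesAt 𝒟 := Iff.rfl

/-- The Minkowski development `(ℝ⁴, η, ∂ₜ; y ↦ (0,y))` of the trivial data. -/
abbrev 𝒟₀ := Minkowski.vacuumCauchyDevelopment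

-- the metric and time orientation of `𝒟₀` with carrier syntactically `E4` (fields by `rfl`)
local notation "η₄" => (Minkowski.smoothMetric)
local notation "∂ₜ" => (TimeOrientation.ofLE (n' := (∞ : ℕ∞ω)) Minkowski.timeOrientation le_top)

theorem metric_𝒟₀ : 𝒟₀.metric = η₄ := rfl

theorem timeOrientation_𝒟₀ : 𝒟₀.timeOrientation = ∂ₜ := rfl

/-- The data hypersurface of `𝒟₀` is `{x⁰ = 0}`. -/
theorem range_embed : range 𝒟₀.embed = {x : E4 | x 0 = 0} :=
  Set.ext fun x ↦ E4.mem_range_sliceEmbed_iff x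

/-- `J⁺({x⁰ = 0})` is the closed upper half-space. -/
theorem causalFuture_hyperplane :
    LorentzianMetric.causalFuture η₄ ∂ₜ {x : E4 | x 0 = 0} = {x : E4 | 0 ≤ x 0} := by
  ext q
  constructor
  · intro hq
    rw [LorentzianMetric.causalFuture_eq_biUnion] at hq
    simp only [mem_iUnion, exists_prop] at hq
    obtain ⟨p, hp, hqp⟩ := hq
    have hp0 : p 0 = 0 := hp
    have h1 : ‖E4.spatial q - E4.spatial p‖ ≤ q 0 - p 0 :=
      (Set.ext_iff.mp (Minkowski.causalFuture_singleton p) q).mp hqp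
    have h0 : (0 : ℝ) ≤ q 0 - p 0 := (norm_nonneg _).trans h1
    show 0 ≤ q 0
    linarith
  · intro hq
    have hp : E4.ofTimeSpace 0 (E4.spatial q) ∈ {x : E4 | x 0 = 0} := E4.ofTimeSpace_apply_zero _ _
    refine LorentzianMetric.causalFuture_mono (g := η₄) (τ := ∂ₜ) (singleton_subset_iff.mpr hp) ?_
    rw [Minkowski.causalFuture_singleton]
    show ‖E4.spatial q - E4.spatial (E4.ofTimeSpace 0 (E4.spatial q))‖ ≤
      q 0 - E4.ofTimeSpace 0 (E4.spatial q) 0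
    rw [E4.spatial_ofTimeSpace, sub_self, norm_zero, E4.ofTimeSpace_apply_zero, sub_zero]
    exact hq

/-- Vertical segments `σ ↦ x + σ s ∂ₜ` (`s > 0`) are future timelike curves of Minkowski space. -/
theorem isFutureTimelikeCurveOn_vertical (x : E4) {s : ℝ} (hs : 0 < s) (dom : Set ℝ) :
    LorentzianMetric.IsFutureTimelikeCurveOn η₄ ∂ₜ (fun σ : ℝ ↦ x + σ • (s • E4.basisVector 0)) dom := by
  intro σ _
  set v : E4 := s • E4.basisVector 0 with hv_def
  have hγ : HasDerivAt (fun σ : ℝ ↦ x + σ • v) v σ := by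
    simpa using ((hasDerivAt_id σ).smul_const v).const_add x
  have hmd : MDifferentiableAt 𝓘(ℝ, ℝ) 𝓘(ℝ, E4) (fun σ : ℝ ↦ x + σ • v) σ :=
    mdifferentiableAt_iff_differentiableAt.mpr hγ.differentiableAt
  have hvel : velocity 𝓘(ℝ, E4) (fun σ : ℝ ↦ x + σ • v) σ = v := by
    unfold velocity
    rw [mfderiv_eq_fderiv]
    change fderiv ℝ (fun σ : ℝ ↦ x + σ • v) σ 1 = v
    rw [hγ.hasFDerivAt.fderiv]
    simp
  have hv0 : v 0 = s := by simp [hv_def, E4.basisVector]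
  have hev : Minkowski.bilin (E4.basisVector 0) v = -s := by
    rw [Minkowski.bilin_basisVector_zero_left, hv0]
  have hvv : Minkowski.bilin v v = -(s * s) := by
    have h1 : Minkowski.bilin v = s • Minkowski.bilin (E4.basisVector 0) := by
      rw [hv_def, map_smul]
    rw [h1, FunLike.coe_smul, Pi.smul_apply, hev, smul_eq_mul, mul_neg]
  have hvne : v ≠ 0 := by
    intro h
    have := congrArg (fun w : E4 ↦ w 0) h
    simp only [hv0] at this
    have h0 : (0 : E4) 0 = 0 := rfl
    rw [h0] at this
    exact hs.ne' this
  have hss : 0 < s * s := mul_pos hs hs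
  refine ⟨hmd, ?_, ⟨?_, ?_⟩, ?_⟩
  · change Minkowski.bilin (velocity 𝓘(ℝ, E4) (fun σ : ℝ ↦ x + σ • v) σ)
      (velocity 𝓘(ℝ, E4) (fun σ : ℝ ↦ x + σ • v) σ) < 0
    rw [hvel, hvv]
    linarith
  · change Minkowski.bilin (velocity 𝓘(ℝ, E4) (fun σ : ℝ ↦ x + σ • v) σ)
      (velocity 𝓘(ℝ, E4) (fun σ : ℝ ↦ x + σ • v) σ) ≤ 0
    rw [hvel, hvv]
    linarith
  · change velocity 𝓘(ℝ, E4) (fun σ : ℝ ↦ x + σ • v) σ ≠ 0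
    rw [hvel]; exact hvne
  · change Minkowski.bilin (E4.basisVector 0) (velocity 𝓘(ℝ, E4) (fun σ : ℝ ↦ x + σ • v) σ) < 0
    rw [hvel, hev]
    linarith

/-- Every event is chronologically below the late half-space `{x⁰ > 1}`. -/
theorem chronologicalPast_late :
    LorentzianMetric.chronologicalPast η₄ ∂ₜ {x : E4 | 1 < x 0} = univ := by
  refine eq_univ_of_forall fun x ↦ ?_
  set s : ℝ := |x 0| + 2 with hs_def
  have hs : 0 < s := by positivity
  set q : E4 := x + s • E4.basisVector 0 with hq_def
  have hq : q ∈ {x : E4 | 1 < x 0} := by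
    show 1 < q 0
    have hq0 : q 0 = x 0 + s := by simp [hq_def, E4.basisVector]
    rw [hq0, hs_def]
    have := neg_abs_le (x 0)
    linarith
  have hxq : q ∈ LorentzianMetric.chronologicalFuture η₄ ∂ₜ {x} :=
    ⟨x, rfl, fun σ : ℝ ↦ x + σ • (s • E4.basisVector 0), 0, 1, zero_lt_one,
      isFutureTimelikeCurveOn_vertical x hs _, by simp, by simp [hq_def]⟩
  have := LorentzianMetric.mem_chronologicalPast_of_mem_chronologicalFuture hxq
  exact LorentzianMetric.chronologicalFuture_mono (g := η₄) (τ := TimeOrientation.reverse ∂ₜ)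
    (singleton_subset_iff.mpr hq) this

/-- A point with `x⁰ ≤ τ` lies in `J⁻` of the hyperplane `{x⁰ = τ}`. -/
theorem mem_causalPast_hyperplane {x : E4} {τ : ℝ} (h : x 0 ≤ τ) :
    x ∈ LorentzianMetric.causalPast η₄ ∂ₜ {y : E4 | y 0 = τ} := by
  have hq : E4.ofTimeSpace τ (E4.spatial x) ∈ {y : E4 | y 0 = τ} := E4.ofTimeSpace_apply_zero _ _
  refine LorentzianMetric.causalFuture_mono (g := η₄) (τ := TimeOrientation.reverse ∂ₜ)
    (singleton_subset_iff.mpr hq) ?_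
  show x ∈ LorentzianMetric.causalPast η₄ ∂ₜ {E4.ofTimeSpace τ (E4.spatial x)}
  rw [Minkowski.causalPast_singleton]
  show ‖E4.spatial (E4.ofTimeSpace τ (E4.spatial x)) - E4.spatial x‖ ≤
    E4.ofTimeSpace τ (E4.spatial x) 0 - x 0
  rw [E4.spatial_ofTimeSpace, sub_self, norm_zero, E4.ofTimeSpace_apply_zero]
  linarith

/-- The late image `{x⁰ > 1}` of the identity flat chart, as a subset of the carrier of `𝒟₀`. -/
def lateImage : Set 𝒟₀.carrier := {x : E4 | 1 < x 0}

theorem mem_image_lateRegion_iff (x : E4) :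
    (x : 𝒟₀.carrier) ∈ (Subtype.val : (⊤ : Opens E4) → E4) '' (Minkowski.backgroundOn ⊤).lateRegion 1 ↔
      1 < x 0 := by
  constructor
  · rintro ⟨y, hy, rfl⟩
    exact hy
  · intro hx
    exact ⟨⟨x, trivial⟩, hx, rfl⟩

theorem hyperplane_subset_image_timeSlab (τ : ℝ) :
    ({y : E4 | y 0 = τ} : Set 𝒟₀.carrier) ⊆
      (Subtype.val : (⊤ : Opens E4) → E4) '' (Minkowski.backgroundOn ⊤).timeSlab τ :=
  fun y hy ↦ ⟨⟨y, trivial⟩, hy, rfl⟩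

/-- The self-determined exterior of the late image is the closed upper half-space `{x⁰ ≥ 0}`. -/
def O₀ : Set 𝒟₀.carrier := exteriorOf 𝒟₀.toCauchyDevelopment lateImage

theorem O₀_eq : O₀ = {x : E4 | 0 ≤ x 0} := by
  unfold O₀ exteriorOf
  rw [range_embed]
  change LorentzianMetric.causalFuture η₄ ∂ₜ {x : E4 | x 0 = 0} ∩
    LorentzianMetric.chronologicalPast η₄ ∂ₜ {x : E4 | 1 < x 0} = {x : E4 | 0 ≤ x 0}
  rw [causalFuture_hyperplane, chronologicalPast_late, inter_univ]

/-- A point of the carrier with `x⁰ ≤ τ` lies in `J⁻` of the image of the flat slab `{x⁰ = τ}`. -/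
theorem mem_causalPast_timeSlab {x : E4} {τ : ℝ} (h : x 0 ≤ τ) :
    (x : 𝒟₀.carrier) ∈ 𝒟₀.metric.causalPast 𝒟₀.timeOrientation
      ((Subtype.val : (⊤ : Opens E4) → E4) '' (Minkowski.backgroundOn ⊤).timeSlab τ) :=
  LorentzianMetric.causalFuture_mono (g := 𝒟₀.metric) (τ := 𝒟₀.timeOrientation.reverse)
    (hyperplane_subset_image_timeSlab τ) (mem_causalPast_hyperplane h)

/-- The honest `N = 0` decomposition of Minkowski space: identity flat chart on `⊤` after `τ₀ = 1`. -/
def d₀ : FinalStateDecomposition 𝒟₀.toSpacetime O₀ 4 where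
  N := 0
  mass := Fin.elim0
  spin := Fin.elim0
  mass_pos i := i.elim0
  abs_spin_le_mass i := i.elim0
  motion := Fin.elim0
  τ₀ := 1
  chart i := i.elim0
  isLateChart i := i.elim0
  tendsto_truncDeviationCk i := i.elim0
  exists_pairwise_disjoint _ := ⟨0, fun i ↦ i.elim0⟩
  excision := Fin.elim0
  tendsto_excision_div i := i.elim0
  flatDomain := ⊤
  setOf_lt_excision_subset_flatDomain _ _ := trivial
  flatChart := Subtype.val
  isLateChart_flat :=
    ⟨(Minkowski.isLateChart_vacuumCauchyDevelopment_subtypeVal 1).contMDiff,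
      (Minkowski.isLateChart_vacuumCauchyDevelopment_subtypeVal 1).isOpenEmbedding, by
        rintro _ ⟨y, hy, rfl⟩
        rw [O₀_eq]
        have hy' : (1 : ℝ) < y.1 0 := hy
        show (0 : ℝ) ≤ y.1 0
        linarith⟩
  tendsto_deviationCk_flat := by
    simp only [Minkowski.deviationCk_vacuumCauchyDevelopment_subtypeVal]
    exact tendsto_const_nhds
  diff_subset_causalPast := by
    rw [iUnion_of_empty, empty_union, iUnion_of_empty, empty_union]
    intro x hx
    obtain ⟨hxO, hxL⟩ := hx
    rw [O₀_eq] at hxO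
    have hx0 : (0 : ℝ) ≤ E4.time x := hxO
    have hx1 : ¬ (1 : ℝ) < E4.time x := fun h1 ↦ hxL ⟨⟨x, trivial⟩, h1, rfl⟩
    exact mem_causalPast_timeSlab (x := x) (not_lt.mp hx1)

theorem d₀_N : d₀.N = 0 := rfl

theorem charted_d₀ : d₀.charted = lateImage := by
  haveI : IsEmpty (Fin d₀.N) := Fin.isEmpty'
  rw [FinalStateDecomposition.charted, FinalStateDecomposition.radiationZone, iUnion_of_empty,
    union_empty]
  ext x
  exact mem_image_lateRegion_iff x

theorem O₀_eq_exteriorOf : O₀ = exteriorOf 𝒟₀.toCauchyDevelopment d₀.charted := by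
  rw [charted_d₀]; rfl

/-- `HonestCore` on Minkowski: only C4 is live, and `dι(∂₀) = ∂₀` is future-directed. -/
theorem honestCore_d₀ (R₀ : ℝ) : HonestCore 𝒟₀.toSpacetime O₀ 4 d₀ R₀ := by
  rw [honestCore_iff_of_N_eq_zero d₀ d₀_N]
  intro y _
  have h := OpensChart.mfderiv_subtypeVal_apply (U := (⊤ : Opens E4)) y (E4.basisVector 0)
  show 𝒟₀.timeOrientation.IsFutureDirected
    (mfderiv 𝓘(ℝ, E4) 𝓘(ℝ, E4) (Subtype.val : (⊤ : Opens E4) → E4) y (E4.basisVector 0))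
  rw [h]
  exact 𝒟₀.timeOrientation.isFutureDirected_vectorField y.1

/-- `HonestFar` on Minkowski: flat-late points are below later flat slabs, late half-spaces are
closed. -/
theorem honestFar_d₀ (R₀ : ℝ) : HonestFar 𝒟₀.toSpacetime O₀ 4 d₀ R₀ := by
  rw [honestFar_iff_of_N_eq_zero d₀ d₀_N]
  refine ⟨fun τ₂ _ ↦ ?_, fun τ' _ ↦ ?_⟩
  · rintro _ ⟨y, ⟨-, hy⟩, rfl⟩
    exact mem_causalPast_timeSlab (x := y.1) (le_of_lt hy)
  · have himg : ((Subtype.val : (⊤ : Opens E4) → E4) '' {y : (⊤ : Opens E4) | τ' ≤ y.1 0} :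
        Set 𝒟₀.carrier) = {x : E4 | τ' ≤ x 0} := by
      ext x
      constructor
      · rintro ⟨y, hy, rfl⟩
        exact hy
      · intro hx
        exact ⟨⟨x, trivial⟩, hx, rfl⟩
    have hcl : IsClosed {x : E4 | τ' ≤ x 0} :=
      isClosed_le continuous_const (PiLp.continuous_apply 2 _ 0)
    show closure ((Subtype.val : (⊤ : Opens E4) → E4) '' {y : (⊤ : Opens E4) | τ' ≤ y.1 0} :
        Set 𝒟₀.carrier) ⊆
      ((Subtype.val : (⊤ : Opens E4) → E4) '' {y : (⊤ : Opens E4) | τ' ≤ y.1 0} : Set 𝒟₀.carrier)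
    rw [himg]
    exact hcl.closure_subset

/-- Minkowski space has complete future null infinity (sojourn form) as a development of the
trivial data: it is null geodesically complete (`minkowski_isGeodesicallyComplete_holds`) and
maximal geodesics are unique (`IsGeodesicOn.eqOn_of_velocity_eq_holds`). -/
theorem hasCompleteNullInfinity_𝒟₀ : HasCompleteNullInfinity 𝒟₀.toCauchyDevelopment := by
  intro _inst
  haveI : Minkowski.spacetime.metric.HasLeviCivita := _inst
  haveI : CovariantDerivative.ContMDiffCovariantDerivative 𝒟₀.metric.leviCivita 1 :=
    ⟨𝒟₀.metric.isLocallyContMDiff_leviCivita_holds 1 (by exact_mod_cast le_top) univ isOpen_univ⟩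
  refine LorentzianMetric.hasCompleteFutureNullInfinity_of_isNullGeodesicallyComplete
    IsGeodesicOn.eqOn_of_velocity_eq_holds ?_ _
  exact ((LorentzianMetric.isCausalGeodesicallyComplete_iff _).mp
    (LorentzianMetric.isCausalGeodesicallyComplete_of_isGeodesicallyComplete _
      minkowski_isGeodesicallyComplete_holds)).2

/-- **Consistency witness.** At the Minkowski development of the trivial data every clause of
`P` holds: complete `𝓘⁺`, and the identity flat chart is an honest fixed-radius decomposition
(`N = 0`, any `R₀`) of the self-determined exterior `{x⁰ ≥ 0} = J⁺(Σ) ∩ I⁻({x⁰ > 1})`. Hence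
`HonestCore ∧ HonestFar ∧ O = exteriorOf` is satisfiable and no refutation of the crux can come
from the clauses alone; what is NOT verified here is maximality (`𝒟₀.IsMaximal`, the
Choquet-Bruhat–Geroch fact) and the transport of the clauses to every other maximal development. -/
theorem settlesAt_minkowski : SettlesAt 𝒟₀ :=
  ⟨hasCompleteNullInfinity_𝒟₀, O₀, d₀, 0, O₀_eq_exteriorOf, honestCore_d₀ 0, honestFar_d₀ 0⟩

/-- The admissible class of `ℝ³` is nonempty (tree: `trivialData_mem_admissibleVacuumData`), so
on `X = Minkowski.slice` the crux is not vacuous; combined with `not_crux_of_forall_not` the only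
formal kill shape left is "`P` fails for EVERY admissible datum on `ℝ³`", which
`settlesAt_minkowski` makes implausible (it would have to fail at trivial data through maximality
alone). -/
theorem not_crux_of_forall_not_slice
    (h : ∀ D ∈ admissibleVacuumData Minkowski.slice, ¬ SettlesHonestly D) :
    ¬ HonestFixedRadiusSettling :=
  not_crux_of_forall_not Minkowski.slice ⟨_, trivialData_mem_admissibleVacuumData⟩ h

end MinkowskiWitness

/-! ### §7 Maximality is load-bearing (generation 2; kernel-checked over the landed Negative files) -/

section Maximality

/-- The time-truncated Minkowski development `{x⁰ < 1}` of the trivial data (landed, built: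
`Theorems.WeakCosmicCensorshipMGHD.Negative.truncated`; the general `{x⁰ < T}` is
`Theorems.HonestFixedRadiusSettling.Negative.TruncatedMinkowski.development T`). -/
abbrev truncated₁ : VacuumCauchyDevelopment trivialData :=
  Theorems.WeakCosmicCensorshipMGHD.Negative.truncated

/-- **The truncated development fails `SettlesAt`**: its `𝓘⁺` is incomplete (its null rays are maximal
geodesics with affine domain `(-∞, 1)`; landed `not_hasCompleteNullInfinity_truncated`, and for general `T`
`TruncatedMinkowski.not_hasCompleteNullInfinity_development`). -/
theorem not_settlesAt_truncated : ¬ SettlesAt truncated₁ := fun h ↦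
  Theorems.WeakCosmicCensorshipMGHD.Negative.not_hasCompleteNullInfinity_truncated h.1

/-- The crux with the guard `𝒟.IsMaximal →` deleted, codimension as a parameter. -/
def CodimWithoutIsMaximal (m : ℕ) : Prop :=
  ∀ (X : Type) [TopologicalSpace X] [ChartedSpace E3 X] [IsManifold (𝓡 3) ∞ X] [T2Space X]
    [SecondCountableTopology X] [ConnectedSpace X],
    InitialDataSet.IsChristodoulouGeneric (admissibleVacuumData X)
      (fun D ↦ (∃ 𝒟 : VacuumCauchyDevelopment D, 𝒟.IsMaximal) ∧ ∀ 𝒟 : VacuumCauchyDevelopment D, SettlesAt 𝒟) m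

/-- **`P` without the maximality guard FAILS at the admissible trivial datum** (whereas with the guard every
clause holds at `𝒟₀`, §6): any proof of the crux must use `𝒟.IsMaximal`, at least to exclude truncations. -/
theorem settlesHonestly_false_without_isMaximal :
    ¬ ((∃ 𝒟 : VacuumCauchyDevelopment trivialData, 𝒟.IsMaximal) ∧
        ∀ 𝒟 : VacuumCauchyDevelopment trivialData, SettlesAt 𝒟) :=
  fun h ↦ not_settlesAt_truncated (h.2 _)

/-- Codimension `0` of the unguarded statement is still free. -/
theorem codimWithoutIsMaximal_zero : CodimWithoutIsMaximal 0 := fun X _ _ _ _ _ _ ↦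
  isChristodoulouGeneric_zero (admissibleVacuumData X) _

/-- The unguarded crux is STRONGER than the crux (genericity is monotone in the property). -/
theorem crux_of_codimWithoutIsMaximal_one (h : CodimWithoutIsMaximal 1) : HonestFixedRadiusSettling := by
  rw [crux_iff_codim_one]
  intro X _ _ _ _ _ _
  exact isChristodoulouGeneric_mono (fun _ _ hD ↦ ⟨hD.1, fun 𝒟 _ ↦ hD.2 𝒟⟩) (h X)

/-- What the unguarded crux would demand at the trivial datum: an admissible smooth injective curve through it
ALL of whose other members settle at EVERY vacuum Cauchy development — in particular have only complete-`𝓘⁺`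
developments (absurd on paper: truncate in time; not refutable in the tree). -/
theorem codimWithoutIsMaximal_one_obligation (h : CodimWithoutIsMaximal 1) :
    ∃ F : EuclideanSpace ℝ (Fin 1) → InitialDataSet (𝓡 3) Minkowski.slice,
      InitialDataSet.IsSmoothDataFamily 1 F ∧ F 0 = trivialData ∧ Function.Injective F ∧
        (∀ c, F c ∈ admissibleVacuumData Minkowski.slice) ∧
        ∀ c, c ≠ 0 → ∀ 𝒟 : VacuumCauchyDevelopment (F c), HasCompleteNullInfinity 𝒟.toCauchyDevelopment := by
  obtain ⟨F, hF, h0, hinj, hmem, hE⟩ := h Minkowski.slice trivialData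
    ⟨trivialData_mem_admissibleVacuumData, settlesHonestly_false_without_isMaximal⟩
  refine ⟨F, hF, h0, hinj, hmem, fun c hc 𝒟 ↦ ?_⟩
  by_contra hcon
  exact hE c hc ⟨hmem c, fun hP ↦ hcon (hP.2 𝒟).1⟩

end Maximality

/-! ### §8 Generation 3: the live leaf `stub_core` (one atlas at infinity) -/

namespace Core

open Topology
open Summit.FinalStateConjecture.FinalStateConjecture.Theorems.StarvedNecks.OneOverDelta
  (hasCompleteNullInfinity_of_oneAtlas honestFixedRadiusSettling_of_core)

/-! #### §8a Read-back of the leaf (verbatim copies of the skeleton's `blHeight`, `blToKS`, `kerrBL`,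
`OneAtlasAtInfinity`, `OneAtlasSettling`, `KerrEndedHonestSettlingGeneric`, kept in this sub-namespace so that
the crux-plan's sanity file, which opens `Disproof`, sees no name clash) -/

/-- The Boyer–Lindquist height over Kerr–Schild space (skeleton `blHeight`, verbatim). -/
def blHeight (M a : ℝ) (r : ℝ) : ℝ :=
  Real.smoothTransition (r / (4 * M) - 1) *
    ((M / Real.sqrt (M ^ 2 - a ^ 2)) *
        (Kerr.rPlus M a * Real.log (r - Kerr.rPlus M a) - Kerr.rMinus M a * Real.log (r - Kerr.rMinus M a)) -
      (M / Real.sqrt (M ^ 2 - a ^ 2)) *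
        (Kerr.rPlus M a * Real.log (4 * M - Kerr.rPlus M a) - Kerr.rMinus M a * Real.log (4 * M - Kerr.rMinus M a)))

/-- `(t_BL, x_KS) ↦ (t_KS, x_KS)` (skeleton `blToKS`, verbatim). -/
def blToKS (M a : ℝ) (y : E4) : E4 :=
  E4.ofTimeSpace (y 0 + blHeight M a (Kerr.radius a (E4.ofTimeSpace 0 (E4.spatial y)))) (E4.spatial y)

/-- The exact Kerr metric in the `(t_BL, x_KS)` chart (skeleton `kerrBL`, verbatim). -/
def kerrBL (M a : ℝ) (y : E4) : E4 →L[ℝ] E4 →L[ℝ] ℝ :=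
  (Kerr.bilin M a (blToKS M a y)).bilinearComp (fderiv ℝ (blToKS M a) y) (fderiv ℝ (blToKS M a) y)

theorem blHeight_zero_mass (a r : ℝ) : blHeight 0 a r = 0 := by
  simp [blHeight]

theorem blToKS_zero_mass (a : ℝ) : blToKS 0 a = id := by
  funext y
  simp only [blToKS, blHeight_zero_mass, add_zero, id]
  exact E4.ofTimeSpace_time_spatial y

/-- `M = 0`: the exact chart metric is `η` itself (no junk: `H = 0`, the height vanishes by `0/x = 0`). -/
theorem kerrBL_zero_mass (a : ℝ) (y : E4) : kerrBL 0 a y = Minkowski.bilin := by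
  simp only [kerrBL, blToKS_zero_mass, Kerr.bilin_zero_left, fderiv_id]
  ext v w
  simp

section OneAtlas

variable {X : Type} [TopologicalSpace X] [ChartedSpace E3 X] [IsManifold (𝓡 3) ∞ X] [ConnectedSpace X]
  {D : InitialDataSet (𝓡 3) X}

/-- ONE ATLAS AT INFINITY (skeleton `OneAtlasAtInfinity`, verbatim): compact core, `κ > 0`, Kerr end
`0 ≤ M`, `|a| ≤ M`, continuous `R♯ ≥ 16M + |a| + 1` of slope `≤ 2`, ZONE, EXACT, ORIENTED, INJECTIVE,
ATTACHED ×4, COVER, SEPARATED. -/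
def OneAtlas (𝒟 : VacuumCauchyDevelopment D) {O : Set 𝒟.carrier} {k : ℕ}
    (d : FinalStateDecomposition 𝒟.toSpacetime O k) (M a r₁ : ℝ) (φ : Kerr.slice a r₁ → X)
    (Rs : ℝ → ℝ) (Bs : Set X) (κ : ℝ) : Prop :=
  IsCompact Bs ∧ 0 < κ ∧ 0 ≤ M ∧ |a| ≤ M ∧ Continuous Rs ∧ (∀ t, 16 * M + |a| + 1 ≤ Rs t) ∧
  (∀ t t' : ℝ, 0 ≤ t → t ≤ t' → Rs t' ≤ Rs t + 2 * (t' - t)) ∧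
  ({y : E4 | -1 < y 0 ∧ Rs (y 0) < E4.spatialNorm y} ⊆ (d.flatDomain : Set E4)) ∧
  (∀ y : d.flatDomain, -1 < y.1 0 → Rs (y.1 0) < E4.spatialNorm y.1 →
    𝒟.toSpacetime.deviation (Minkowski.backgroundOn d.flatDomain) d.flatChart y =
      kerrBL M a y.1 - Minkowski.bilin) ∧
  (∀ y : d.flatDomain, -1 < y.1 0 → Rs (y.1 0) < E4.spatialNorm y.1 →
    𝒟.timeOrientation.IsFutureDirected (mfderiv 𝓘(ℝ, E4) (𝓡 4) d.flatChart y (E4.basisVector 0))) ∧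
  Set.InjOn d.flatChart {y : d.flatDomain | 0 ≤ y.1 0} ∧
  IsOpenEmbedding φ ∧ ContMDiff 𝓘(ℝ, E3) (𝓡 3) ∞ φ ∧
  (∀ ρ : ℝ, IsCompact (φ '' {x : Kerr.slice a r₁ | ρ < ‖(x : E3)‖})ᶜ) ∧
  (∀ (x : Kerr.slice a r₁) (hx : E4.ofTimeSpace 0 (x : E3) ∈ d.flatDomain), Rs 0 < ‖(x : E3)‖ →
    d.flatChart ⟨E4.ofTimeSpace 0 (x : E3), hx⟩ = 𝒟.embed (φ x)) ∧
  (𝒟.metric.causalFuture 𝒟.timeOrientation (range 𝒟.embed) ⊆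
    𝒟.metric.causalFuture 𝒟.timeOrientation (𝒟.embed '' Bs) ∪
      d.flatChart '' {y : d.flatDomain | 0 ≤ y.1 0 ∧ Rs (y.1 0) < E4.spatialNorm y.1}) ∧
  (∀ (i : Fin d.N) (z : E4), d.τ₀ ≤ z 0 →
    Kerr.radius (d.spin i) (poincareInv (d.motion i).1 (d.motion i).2 z) ≤ d.excision i (z 0) →
      E4.spatialNorm z + κ * z 0 ≤ Rs (z 0))

/-- `Q` at a development: an honest `C⁴` decomposition of the self-determined exterior WITH one atlas at
infinity — the universal conjunct of the leaf's property (skeleton `OneAtlasSettling`, second conjunct). -/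
def CoreAt (𝒟 : VacuumCauchyDevelopment D) : Prop :=
  ∃ (O : Set 𝒟.carrier) (d : FinalStateDecomposition 𝒟.toSpacetime O 4) (R₀ : ℝ),
    O = exteriorOf 𝒟.toCauchyDevelopment d.charted ∧
      HonestCore 𝒟.toSpacetime O 4 d R₀ ∧ HonestFar 𝒟.toSpacetime O 4 d R₀ ∧
        ∃ (M a r₁ : ℝ) (φ : Kerr.slice a r₁ → X) (Rs : ℝ → ℝ) (Bs : Set X) (κ : ℝ),
          OneAtlas 𝒟 d M a r₁ φ Rs Bs κ

/-- The leaf's pointwise property `Q D` (skeleton `OneAtlasSettling`, verbatim up to the names above). -/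
def CoreSettles (D : InitialDataSet (𝓡 3) X) : Prop :=
  (∃ 𝒟 : VacuumCauchyDevelopment D, 𝒟.IsMaximal) ∧ ∀ 𝒟 : VacuumCauchyDevelopment D, 𝒟.IsMaximal → CoreAt 𝒟

/-- **CERT, read back**: one atlas at infinity (any `k ≥ 1`) certifies complete `𝓘⁺` — the landed
`hasCompleteNullInfinity_of_oneAtlas`, the named clauses unfolding to its def-free hypotheses. -/
theorem hasCompleteNullInfinity_of_oneAtlas' [T2Space X] [SecondCountableTopology X]
    (𝒟 : VacuumCauchyDevelopment D) {O : Set 𝒟.carrier} {k : ℕ} (hk : 1 ≤ k)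
    (d : FinalStateDecomposition 𝒟.toSpacetime O k) {M a r₁ : ℝ} {φ : Kerr.slice a r₁ → X} {Rs : ℝ → ℝ}
    {Bs : Set X} {κ : ℝ} (h : OneAtlas 𝒟 d M a r₁ φ Rs Bs κ) :
    HasCompleteNullInfinity 𝒟.toCauchyDevelopment := by
  obtain ⟨h1, h2, h3, h4, h5, h6, h7, h8, h9, h10, h11, h12, h13, h14, h15, h16, h17⟩ := h
  exact hasCompleteNullInfinity_of_oneAtlas X D 𝒟 O k d M a r₁ φ Rs Bs κ hk h1 h2 h3 h4 h5 h6 h7 h8 h9 h10 h11 h12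
    h13 h14 h15 h16 h17

/-- **`Q ⇒ P` at a development**: `CoreAt 𝒟 → SettlesAt 𝒟` (CERT at `k = 4`). -/
theorem settlesAt_of_coreAt [T2Space X] [SecondCountableTopology X] {𝒟 : VacuumCauchyDevelopment D}
    (h : CoreAt 𝒟) : SettlesAt 𝒟 := by
  obtain ⟨O, d, R₀, hO, hc, hf, M, a, r₁, φ, Rs, Bs, κ, h1⟩ := h
  exact ⟨hasCompleteNullInfinity_of_oneAtlas' 𝒟 (by norm_num) d h1, O, d, R₀, hO, hc, hf⟩

/-- `Q ⇒ P` pointwise on data. -/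
theorem settlesHonestly_of_coreSettles [T2Space X] [SecondCountableTopology X] (h : CoreSettles D) :
    SettlesHonestly D :=
  (settlesHonestly_iff D).2 ⟨h.1, fun 𝒟 h𝒟 ↦ settlesAt_of_coreAt (h.2 𝒟 h𝒟)⟩

end OneAtlas

/-- The leaf with the codimension as a parameter; `CoreCodim 1` is `KerrEndedHonestSettlingGeneric`. -/
def CoreCodim (m : ℕ) : Prop :=
  ∀ (X : Type) [TopologicalSpace X] [ChartedSpace E3 X] [IsManifold (𝓡 3) ∞ X] [T2Space X]
    [SecondCountableTopology X] [ConnectedSpace X],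
    InitialDataSet.IsChristodoulouGeneric (admissibleVacuumData X) CoreSettles m

/-- **READ-BACK CHECK = the line's reduction**: `CoreCodim 1 → crux` IS the landed
`honestFixedRadiusSettling_of_core`, applied verbatim (its def-free hypothesis unfolds to `CoreCodim 1`). -/
theorem crux_of_coreCodim_one (h : CoreCodim 1) : HonestFixedRadiusSettling :=
  honestFixedRadiusSettling_of_core h

/-- **Any refutation of the crux refutes the leaf** (the leaf is at least as strong as the crux). -/
theorem not_coreCodim_one_of_not_crux (hn : ¬ HonestFixedRadiusSettling) : ¬ CoreCodim 1 :=
  fun h ↦ hn (crux_of_coreCodim_one h)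

/-- Codimension `0` is free for the leaf as for the crux: its `1` is the content. -/
theorem coreCodim_zero : CoreCodim 0 := fun X _ _ _ _ _ _ ↦
  isChristodoulouGeneric_zero (admissibleVacuumData X) CoreSettles

/-! #### §8b The one-atlas clauses exclude time truncation -/

/-- **No one atlas at infinity on a time truncation**: on `{x⁰ < T}` NO `Cᵏ` (`k ≥ 1`) final-state
decomposition of any region satisfies the seventeen clauses — CERT would give complete `𝓘⁺`, which the
truncation lacks. (Paper reading: EXACT + ZONE + ATTACHED alone already fail there — the vertical chart lines
over a fixed far point are timelike curves from `Σ` of unbounded proper time inside a slab of height `T`.) -/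
theorem not_oneAtlas_truncated {O : Set truncated₁.carrier} {k : ℕ} (hk : 1 ≤ k)
    (d : FinalStateDecomposition truncated₁.toSpacetime O k) (M a r₁ : ℝ)
    (φ : Kerr.slice a r₁ → Minkowski.slice) (Rs : ℝ → ℝ) (Bs : Set Minkowski.slice) (κ : ℝ) :
    ¬ OneAtlas truncated₁ d M a r₁ φ Rs Bs κ := fun h ↦
  Theorems.WeakCosmicCensorshipMGHD.Negative.not_hasCompleteNullInfinity_truncated
    (hasCompleteNullInfinity_of_oneAtlas' truncated₁ hk d h)

/-- Hence `Q`'s universal conjunct fails at the truncated development. -/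
theorem not_coreAt_truncated : ¬ CoreAt truncated₁ := by
  rintro ⟨O, d, R₀, -, -, -, M, a, r₁, φ, Rs, Bs, κ, h⟩
  exact not_oneAtlas_truncated (by norm_num) d M a r₁ φ Rs Bs κ h

/-! #### §8c The maximality guard of the leaf is load-bearing -/

/-- The leaf with the guard `𝒟.IsMaximal →` deleted, codimension as a parameter. -/
def CoreCodimWithoutIsMaximal (m : ℕ) : Prop :=
  ∀ (X : Type) [TopologicalSpace X] [ChartedSpace E3 X] [IsManifold (𝓡 3) ∞ X] [T2Space X]
    [SecondCountableTopology X] [ConnectedSpace X],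
    InitialDataSet.IsChristodoulouGeneric (admissibleVacuumData X)
      (fun D ↦ (∃ 𝒟 : VacuumCauchyDevelopment D, 𝒟.IsMaximal) ∧ ∀ 𝒟 : VacuumCauchyDevelopment D, CoreAt 𝒟) m

/-- **Without the guard the TRIVIAL DATUM is exceptional for `Q`** (its truncated development carries no one
atlas, §8b), although every clause of `Q` holds at `𝒟₀` (§8d): any proof of `stub_core` must use maximality. -/
theorem coreSettles_false_without_isMaximal :
    ¬ ((∃ 𝒟 : VacuumCauchyDevelopment trivialData, 𝒟.IsMaximal) ∧
        ∀ 𝒟 : VacuumCauchyDevelopment trivialData, CoreAt 𝒟) :=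
  fun h ↦ not_coreAt_truncated (h.2 _)

/-- The unguarded leaf is stronger than the leaf. -/
theorem coreCodim_one_of_withoutIsMaximal (h : CoreCodimWithoutIsMaximal 1) : CoreCodim 1 :=
  fun X _ _ _ _ _ _ ↦ isChristodoulouGeneric_mono (fun _ _ hD ↦ ⟨hD.1, fun 𝒟 _ ↦ hD.2 𝒟⟩) (h X)

/-- Codimension `0` of the unguarded leaf is still free. -/
theorem coreCodimWithoutIsMaximal_zero : CoreCodimWithoutIsMaximal 0 := fun X _ _ _ _ _ _ ↦
  isChristodoulouGeneric_zero (admissibleVacuumData X) _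

/-- The obligation the unguarded leaf would create at the trivial datum: an admissible smooth injective curve
through it all of whose other members carry one atlas at infinity on EVERY vacuum Cauchy development
(absurd on paper by §8b applied to a truncation of any development; not refutable in the tree). -/
theorem coreCodimWithoutIsMaximal_one_obligation (h : CoreCodimWithoutIsMaximal 1) :
    ∃ F : EuclideanSpace ℝ (Fin 1) → InitialDataSet (𝓡 3) Minkowski.slice,
      InitialDataSet.IsSmoothDataFamily 1 F ∧ F 0 = trivialData ∧ Function.Injective F ∧
        (∀ c, F c ∈ admissibleVacuumData Minkowski.slice) ∧
        ∀ c, c ≠ 0 → ∀ 𝒟 : VacuumCauchyDevelopment (F c), CoreAt 𝒟 := by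
  obtain ⟨F, hF, h0, hinj, hmem, hE⟩ := h Minkowski.slice trivialData
    ⟨trivialData_mem_admissibleVacuumData, coreSettles_false_without_isMaximal⟩
  refine ⟨F, hF, h0, hinj, hmem, fun c hc 𝒟 ↦ ?_⟩
  by_contra hcon
  exact hE c hc ⟨hmem c, fun hP ↦ hcon (hP.2 𝒟)⟩

/-! #### §8d Consistency witness for the leaf: one atlas at infinity at the Minkowski development
(the crux-plan's `oneAtlasAtInfinity_minkowski`, re-proved here so that this file is self-contained) -/

section MinkowskiCore

open Minkowski TopologicalSpace

/-- `Kerr.slice 0 0 ≤ ⊤ = Minkowski.slice`. -/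
theorem kerrSlice_le_top : Kerr.slice 0 0 ≤ (Minkowski.slice : Opens E3) := le_top

/-- The end attachment: the inclusion of the punctured `t* = 0` leaf into the Minkowski slice. -/
def φIncl : Kerr.slice 0 0 → Minkowski.slice := Opens.inclusion kerrSlice_le_top

/-- The compact core: the closed ball of radius `2`. -/
def coreBall : Set Minkowski.slice := {x | ‖(x : E3)‖ ≤ 2}

theorem isCompact_coreBall : IsCompact coreBall := by
  rw [Subtype.isCompact_iff]
  have : ((↑) : Minkowski.slice → E3) '' coreBall = Metric.closedBall (0 : E3) 2 := by
    ext x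
    simp only [coreBall, mem_image, mem_setOf_eq, Metric.mem_closedBall, dist_zero_right]
    constructor
    · rintro ⟨y, hy, rfl⟩; exact hy
    · intro hx; exact ⟨⟨x, trivial⟩, hx, rfl⟩
  rw [this]
  exact isCompact_closedBall _ _

/-- The far sets of `φIncl` have compact complements (the closed ball of radius `max ρ 0`, puncture included). -/
theorem val_image_compl_image_φIncl (ρ : ℝ) :
    ((↑) : Minkowski.slice → E3) '' (φIncl '' {x : Kerr.slice 0 0 | ρ < ‖(x : E3)‖})ᶜ =
      Metric.closedBall (0 : E3) (max ρ 0) := by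
  ext z
  simp only [mem_image, mem_compl_iff, mem_setOf_eq, Metric.mem_closedBall, dist_zero_right]
  constructor
  · rintro ⟨y, hy, rfl⟩
    by_contra hlt
    push Not at hlt
    apply hy
    have hy0 : 0 < ‖(y : E3)‖ := lt_of_le_of_lt (le_max_right _ _) hlt
    have hyρ : ρ < ‖(y : E3)‖ := lt_of_le_of_lt (le_max_left _ _) hlt
    have hmem : (y : E3) ∈ Kerr.slice 0 0 := by
      rw [Kerr.mem_slice, Kerr.radius_zero_left, E4.spatialNorm_ofTimeSpace, max_self]
      exact hy0
    exact ⟨⟨(y : E3), hmem⟩, hyρ, rfl⟩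
  · intro hz
    refine ⟨⟨z, trivial⟩, ?_, rfl⟩
    rintro ⟨x, hx, hxz⟩
    have hxz' : (x : E3) = z := congrArg Subtype.val hxz
    have hx0 : 0 < ‖(x : E3)‖ := by
      have h2 := x.2
      rw [Kerr.mem_slice, Kerr.radius_zero_left, E4.spatialNorm_ofTimeSpace, max_self] at h2
      exact h2
    rw [hxz'] at hx hx0
    rcases le_total ρ 0 with hρ | hρ
    · rw [max_eq_right hρ] at hz
      linarith
    · rw [max_eq_left hρ] at hz
      linarith

theorem isCompact_compl_image_φIncl (ρ : ℝ) :
    IsCompact (φIncl '' {x : Kerr.slice 0 0 | ρ < ‖(x : E3)‖})ᶜ := by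
  rw [Subtype.isCompact_iff, val_image_compl_image_φIncl]
  exact isCompact_closedBall _ _

/-- **One atlas at infinity at Minkowski** (`M = a = r₁ = 0`, identity flat chart `d₀`, `R♯ ≡ 1`, core =
closed 2-ball, `κ = 1`): every clause holds. -/
theorem oneAtlas_minkowski : OneAtlas 𝒟₀ d₀ 0 0 0 φIncl (fun _ ↦ 1) coreBall 1 := by
  refine ⟨isCompact_coreBall, one_pos, le_rfl, by simp, continuous_const, fun t ↦ by simp,
    fun t t' ht htt' ↦ by linarith, fun _ _ ↦ trivial, ?_, ?_, ?_, ?_, ?_, isCompact_compl_image_φIncl, ?_, ?_, ?_⟩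
  · -- EXACT: the identity chart has deviation 0 = kerrBL 0 0 − η
    intro y _ _
    refine (Minkowski.deviation_vacuumCauchyDevelopment_subtypeVal y).trans ?_
    rw [kerrBL_zero_mass]
    exact (sub_self (Minkowski.bilin : E4 →L[ℝ] E4 →L[ℝ] ℝ)).symm
  · -- ORIENTED: dι(∂₀) = ∂₀ is future-directed
    intro y _ _
    have h := OpensChart.mfderiv_subtypeVal_apply (U := (⊤ : Opens E4)) y (E4.basisVector 0)
    show 𝒟₀.timeOrientation.IsFutureDirected
      (mfderiv 𝓘(ℝ, E4) 𝓘(ℝ, E4) (Subtype.val : (⊤ : Opens E4) → E4) y (E4.basisVector 0))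
    rw [h]
    exact 𝒟₀.timeOrientation.isFutureDirected_vectorField y.1
  · -- INJECTIVE
    intro y _ y' _ h
    exact Subtype.ext h
  · -- φIncl is an open embedding
    exact TopologicalSpace.Opens.isOpenEmbedding_of_le kerrSlice_le_top
  · -- φIncl is smooth
    exact contMDiff_inclusion kerrSlice_le_top
  · -- ATTACHED: ι(φ x) = (0, x) = the identity chart at (0, x)
    intro x hx _
    rfl
  · -- COVER: J⁺({x⁰ = 0}) = {x⁰ ≥ 0} ⊆ J⁺(ι core) ∪ {x⁰ ≥ 0, |x⃗| > 1}
    have key : 𝒟₀.metric.causalFuture 𝒟₀.timeOrientation (range 𝒟₀.embed) = ({x : E4 | 0 ≤ x 0} : Set E4) := by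
      rw [range_embed]
      exact causalFuture_hyperplane
    intro q hq
    rw [key] at hq
    have hq0 : 0 ≤ E4.time q := hq
    by_cases hfar : 1 < E4.spatialNorm q
    · exact Or.inr ⟨⟨q, trivial⟩, ⟨hq0, hfar⟩, rfl⟩
    · left
      push Not at hfar
      have hp : E4.ofTimeSpace 0 (E4.spatial q) ∈ 𝒟₀.embed '' coreBall := by
        refine ⟨⟨E4.spatial q, trivial⟩, ?_, rfl⟩
        show ‖E4.spatial q‖ ≤ 2
        have : E4.spatialNorm q = ‖E4.spatial q‖ := rfl
        linarith
      have hqp : (q : 𝒟₀.carrier) ∈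
          𝒟₀.metric.causalFuture 𝒟₀.timeOrientation {E4.ofTimeSpace 0 (E4.spatial q)} := by
        have h' : ‖E4.spatial q - E4.spatial (E4.ofTimeSpace 0 (E4.spatial q))‖ ≤
            E4.time q - (E4.ofTimeSpace 0 (E4.spatial q)) 0 := by
          rw [E4.spatial_ofTimeSpace, sub_self, norm_zero, E4.ofTimeSpace_apply_zero, sub_zero]
          exact hq0
        exact (Set.ext_iff.mp (Minkowski.causalFuture_singleton (E4.ofTimeSpace 0 (E4.spatial q))) q).mpr h'
      exact LorentzianMetric.causalFuture_mono (g := 𝒟₀.metric) (τ := 𝒟₀.timeOrientation)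
        (singleton_subset_iff.mpr hp) hqp
  · -- SEPARATED: no holes
    haveI : IsEmpty (Fin d₀.N) := d₀_N ▸ Fin.isEmpty'
    intro i
    exact (IsEmpty.false i).elim

/-- **Consistency witness for the leaf.** At the Minkowski development of the trivial data the universal
conjunct of `Q` holds: honest `N = 0` decomposition `d₀` of `O₀` (§6) with one atlas at infinity. Hence
`Q(trivialData)` can only fail through `IsMaximal` (the Choquet-Bruhat–Geroch fact, not in the tree), exactly as
`P`; combined with §8c, maximality is the one hypothesis separating the leaf's truth at the simplest datum from
its falsity. -/
theorem coreAt_minkowski : CoreAt 𝒟₀ :=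
  ⟨O₀, d₀, 0, O₀_eq_exteriorOf, honestCore_d₀ 0, honestFar_d₀ 0, 0, 0, 0, φIncl, fun _ ↦ 1, coreBall, 1,
    oneAtlas_minkowski⟩

/-- And `SettlesAt 𝒟₀` is recovered from the leaf's clauses through CERT (a second proof of §6's
`settlesAt_minkowski`, this time with complete `𝓘⁺` certified by the line's wrapper instead of geodesic
completeness). -/
example : SettlesAt 𝒟₀ := settlesAt_of_coreAt coreAt_minkowski

end MinkowskiCore

/-! #### §8e Paper findings of generation 3 (documentation)

1. THE ADMISSIBLE CLASS IS A REST-FRAME CLASS. `admissibleVacuumData` asks `k = o₁(r⁻²)`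
   (`IsStronglyAsymptoticallyFlatDR`, rates `(1, 2)`), so the ADM linear momentum
   `Pᵢ = (8π)⁻¹ lim ∮ (k_ij − tr k δ_ij) νʲ` of EVERY admissible datum VANISHES (`o(r⁻²) · 4πr² → 0`). Consequences
   for the leaf: (i) its EXACT clause (unboosted `kerrBL M a`, Kerr in its rest frame) is not an extra
   normalisation — a Kerr-ENDED admissible datum is automatically rest-frame-ended, because a boosted Kerr slice
   has `k ≍ P/r²`, not `o(r⁻²)`; (ii) gen 2's "momentum compensation when `P_ADM(D) ≠ 0`" (§7c of v4) is vacuous;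
   (iii) Corvino–Schoen / Chruściel–Delay exterior Kerr gluing (Mao–Oh–Tao Thm 1.6: 10-charge matching, the Kerr
   member generically BOOSTED by the approximate momentum of the inner region at the gluing radius) generically
   produces INADMISSIBLE data, so the witness curves of `stub_core` must use OBSTRUCTION-FREE gluing onto a
   rest-frame Kerr end with a positive mass gap, `ΔE > |ΔP| = 0` (Mao–Oh–Tao Thm 1.10 / Czimek–Rodnianski;
   read: glue.pdf pp. 8–10, Thm 1.10 and Remark 1.11 — the gap cannot be closed, by the positive mass theorem),
   which is exactly the sibling line's "non-DR-small mass-jump schedule"; smooth dependence of that gluing on the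
   surgery radius is unprinted (MOT Remark 1.9 gives Lipschitz continuity at unit scale only).
2. EXACT KERR ENDS ARE ADMISSIBLE. The `t_BL = 0` slice of Kerr `(M, a)` in Kerr–Schild space coordinates has
   `h = δ + (2M/r) x̂⊗x̂ + O(r⁻²)`, which is NOT `(1 + 2M/r)δ + o(r⁻¹)` in these coordinates but becomes
   `(1 + 2M/r)δ + O₂(r⁻²)` after the isotropic radial change `r ↦ r(1 + M/2r)²` (the `AFEnd` chart is
   existential), and `k = (2N)⁻¹ 𝓛_β h ≍ aM/r³ = o₁(r⁻²)` (maximal slices, `tr k = 0`); complete, one end. So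
   Kerr-ended data exist in `admissibleVacuumData` for every sub-extremal and extremal `(M, a)`; no clause of the
   leaf is vacuous for that reason.
3. THE EXCEPTIONAL SET OF `Q` contains every admissible datum that is not exactly Kerr-ended in the sense of
   EXACT + ATTACHED (on a dispersive MGHD, EXACT forces `M = 0`, `Φ|zone` a flat local isometry of the connected
   zone, hence Poincaré, and ATTACHED makes the data leaf eventually planar): e.g. the Minkowski slice
   `x⁰ = log log (e + |x⃗|)` (`|∂f|² = o(r⁻¹)`, `∂²f = o(r⁻²)`: admissible with `M = 0`, Cauchy since `|∂f| ≤ 1/e`).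
   This is no obstruction to genericity (cut-off families `graph(f·χ(c|x⃗|))` are admissible, jointly smooth —
   locally eventually constant in `c` — injective for a non-even schedule, and planar-ended), and it is not
   kernel-checkable: `¬ Q` at a datum needs a MAXIMAL development at which the clauses fail, and maximality of
   even the Minkowski development is the CBG theorem.
4. WHY NO `_false_without_scri` / `_false_without_oneAtlas` SMALL MODEL EXISTS (ceiling argument). Every
   Cauchy development of the trivial data that is an open subset `U` of Minkowski space through `{x⁰ = 0}` has
   `U ∩ {x⁰ > 0} = {x⁰ > 0} ∖ W` with `W` a closed future set (a past endpoint on `W` would trap a timelike curve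
   in `I⁺(W) ⊆ W`). If `W = ∅` then `𝓘⁺` is complete. If `W ≠ ∅`, `U` carries NO `N = 0` final-state
   decomposition with `C¹`-deviation `→ 0` AT ALL: the late leaves `Φ({x⁰ = τ})` are complete, hence ENTIRE
   spacelike graphs `0 ≤ u_τ < ceil_W`, `ceil_W(x) ≤ h + |x − x₀|` for a point `(h, x₀) ∈ W`; near-flatness on
   growing intrinsic balls forces `|∇u_τ(x)|² ≲ ε_τ (h + |x − x₀|)` (else the leaf dips below `x⁰ = 0` along its
   near-null tangent plane), so the leaves become horizontal on every bounded region while the chart's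
   `∂₀`-lines (future timelike, proper time `≈` chart time `→ ∞`) rise vertically through the ceiling within
   chart time `2h + 2` — contradiction. With `N ≥ 1` a flat development carries no hole chart anyway
   (`mass_pos`, `C²` convergence to Kerr with `M > 0` is impossible in a flat region). Hence INSIDE MINKOWSKI
   the decomposition clause of `P` already forces complete `𝓘⁺`; separating `HasCompleteNullInfinity` (or any
   single one-atlas clause with respect to CERT's conclusion) from the rest of `P`/`Q` needs a curved
   development, i.e. nothing the tree can build. The same argument applies verbatim under the Cauchy horizon
   of a would-be central naked singularity (ceiling `T + |x|`): an honest dispersive decomposition cannot live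
   under any finite ceiling — a frame-free route to "decomposition ⇒ complete `𝓘⁺`" that other capture cruxes
   may want (information, not a claim of this file).
5. LINE STATUS. Registered skeleton `cd9b777e…` = tree `Lines/sojourn_needs_only_one_over_delta.lean` (reshape
   v2); stubs `stub_farExit`, `stub_entryBookkeeping`, `stub_flatZoneSojourn` landed and assembled (Cert file,
   p111091); `targets`/`stuck_stubs` empty; the only stub is `stub_core` = `CoreCodim 1` (§8a), at least as
   strong as the crux (`not_coreCodim_one_of_not_crux`) and STRICTLY stronger pointwise (item 3). NO KILL.
6. WHY A KILL IS IMPLAUSIBLE IN PRINCIPLE (structure, not only cost). The crux is IMPLIED by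
   `SwallowTheDatum.ParametricKerrBurial ∧ SwallowTheDatum.MGHDExists ∧ KerrShieldedHonest`
   (ideator 2, `Cruxes/HonestFixedRadiusSettling/SketchIdeator2.lean`, `honestFixedRadiusSettling_of_burial`,
   kernel-checked): bury the datum's core inside an ever larger exact Kerr black hole (receding surgery at radius
   `1/|c|`, joint smoothness does not see infinity), whose domain of outer communication is then EXACTLY Kerr
   whatever the core does (outgoing wavefronts from `r = R_core < r₊` have decreasing `r`), hence honest, with
   complete `𝓘⁺` and one atlas. So any refutation of the crux (or of the leaf) refutes that conjunction, i.e.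
   — `MGHDExists` being Choquet-Bruhat–Geroch and `KerrShieldedHonest` a statement about developments of Kerr-shielded data, whose outer domain is exact Kerr —
   it would have to refute the pure initial-data gluing statement `ParametricKerrBurial`. This is the typed
   genericity's receding-support loophole (WCC battery `GenericityComplement.lean`: on a model class a property
   AND its negation are both typed-generic); it makes the crux close to content-free as a GENERIC statement and
   a counterexample to it essentially impossible, independently of the physics of its clauses. The load-bearing
   table (codimension, maximality guard, vacuum constraints; completeness and second countability redundant) is
   therefore the complete negative-side harvest available in the tree.
-/

end Core

/-! ### §9 Generation 4: line `far-field-surgery` — the stubs A, D′ and the new D″ -/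

namespace Surgery

open Summit.FinalStateConjecture.FinalStateConjecture.Theorems.SwallowTheDatum.ParametricKerrBurial
  (SmoothSectionsOn AgreeAt IsExactSchwarzschildBeyond)
open Summit.FinalStateConjecture.FinalStateConjecture.Theorems.StarvedNecks.FarFieldSurgery
  (IsInteriorProbe IsFarGluingFamily IsRemoteSurgery stub_probePatch honestFixedRadiusSettling_of_surgery
    honestFixedRadiusSettling_of_farAnnulusGluing exists_breathingProbe hCoeff_kCoeff_congr_of_agree_far)
open Summit.FinalStateConjecture.FinalStateConjecture.Theorems.HonestFixedRadiusSettling.Negative (coreSet)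

/-! #### §9a Read-back of the registered stubs (skeleton `4a983fe8fc73`) and of the two tree reductions -/

/-- **A — `FarGluing`** (registered `stub_farGluing`, verbatim): far-gluing family in the SHRINKING schedule
`m R ↓ M₀` with `sobDev → 0`, along every sole DR end, beyond every radius (parametric Mao–Oh–Tao Thm 1.7). -/
def FarGluing : Prop :=
  ∀ (X : Type) [TopologicalSpace X] [ChartedSpace E3 X] [IsManifold (𝓡 3) ∞ X] [T2Space X]
    [SecondCountableTopology X] [ConnectedSpace X], ∀ d ∈ admissibleVacuumData X,
    ∀ (e : AFEnd X) (M₀ R₀ : ℝ), e.IsSoleEnd → e.IsStronglyAsymptoticallyFlatDR d M₀ → e.R < R₀ →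
      ∃ (Rstar : ℝ) (m : ℝ → ℝ) (G : ℝ → InitialDataSet (𝓡 3) X), IsFarGluingFamily d e M₀ R₀ Rstar m G

/-- **D′ — `StableUnfoldingOneAtlas`** (registered `stub_stableUnfoldingOneAtlas`, verbatim): the stable-unfolding
core over REMOTE SURGERIES (shrinking schedule, `sobDev`-small). -/
def StableUnfoldingOneAtlas : Prop :=
  ∀ (X : Type) [TopologicalSpace X] [ChartedSpace E3 X] [IsManifold (𝓡 3) ∞ X] [T2Space X]
    [SecondCountableTopology X] [ConnectedSpace X], ∀ d ∈ admissibleVacuumData X,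
    ∃ (e : AFEnd X) (M₀ R₀ : ℝ) (E : ℝ → InitialDataSet (𝓡 3) X) (x₀ : X)
      (v₀ : TangentSpace (𝓡 3) x₀),
      e.IsSoleEnd ∧ e.IsStronglyAsymptoticallyFlatDR d M₀ ∧ IsInteriorProbe d e R₀ E ∧
        x₀ ∉ e.far R₀ ∧ Set.InjOn (fun t : ℝ ↦ (E t).h.inner x₀ v₀ v₀) (Set.Ioo (-1) 1) ∧
        ∀ (Rstar : ℝ) (m : ℝ → ℝ) (S : ℝ × ℝ → InitialDataSet (𝓡 3) X),
          IsRemoteSurgery d e M₀ R₀ E Rstar m S →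
            ∃ ρ : ℝ → ℝ, ContinuousOn ρ {t : ℝ | t ≠ 0} ∧
              ∀ R t : ℝ, Rstar < R → ρ t ≤ R → t ≠ 0 → |t| < 1 → S (R, t) ∈ coreSet X

/-- **A″ — `FarAnnulusGluingAt`**: SwallowTheDatum's `FarAnnulusGluing` (stmt-15427) per datum, over the tree
abbreviations (GROWING schedule `m R ≥ ηR`, exact Schwarzschild beyond `32R`, NO smallness at scale `R`). -/
def FarAnnulusGluingAt : Prop :=
  ∀ (X : Type) [TopologicalSpace X] [ChartedSpace E3 X] [IsManifold (𝓡 3) ∞ X] [T2Space X]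
    [SecondCountableTopology X] [ConnectedSpace X], ∀ d ∈ admissibleVacuumData X,
    ∃ (η : ℝ) (e : AFEnd X) (Rstar : ℝ) (m : ℝ → ℝ) (G : ℝ → InitialDataSet (𝓡 3) X),
      0 < η ∧ e.IsSoleEnd ∧ e.R < Rstar ∧ ContDiff ℝ ∞ m ∧
      SmoothSectionsOn 𝓘(ℝ, ℝ) G {p : ℝ × X | Rstar < p.1} ∧
      ∀ R : ℝ, Rstar < R → G R ∈ admissibleVacuumData X ∧ (∀ x ∉ e.far R, AgreeAt (G R) d x) ∧
        η * R ≤ m R ∧ IsExactSchwarzschildBeyond e (G R) (m R) (32 * R)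

/-- **D″ — `StableUnfoldingGrowing`** (registered `stub_stableUnfoldingGrowing`, verbatim): the stable-unfolding
core over EVERY far-gluing family in the growing schedule (refuted on paper, §9b). -/
def StableUnfoldingGrowing : Prop :=
  ∀ (X : Type) [TopologicalSpace X] [ChartedSpace E3 X] [IsManifold (𝓡 3) ∞ X] [T2Space X]
    [SecondCountableTopology X] [ConnectedSpace X], ∀ d ∈ admissibleVacuumData X,
    ∀ (η : ℝ) (e : AFEnd X) (Rstar : ℝ) (m : ℝ → ℝ) (G : ℝ → InitialDataSet (𝓡 3) X),
      0 < η → e.IsSoleEnd → e.R < Rstar → ContDiff ℝ ∞ m →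
      SmoothSectionsOn 𝓘(ℝ, ℝ) G {p : ℝ × X | Rstar < p.1} →
      (∀ R : ℝ, Rstar < R → G R ∈ admissibleVacuumData X ∧ (∀ x ∉ e.far R, AgreeAt (G R) d x) ∧
        η * R ≤ m R ∧ IsExactSchwarzschildBeyond e (G R) (m R) (32 * R)) →
      ∃ (R₀ : ℝ) (E : ℝ → InitialDataSet (𝓡 3) X) (x₀ : X) (v₀ : TangentSpace (𝓡 3) x₀),
        e.R < R₀ ∧ R₀ < Rstar ∧ SmoothSectionsOn 𝓘(ℝ, ℝ) E (Set.univ : Set (ℝ × X)) ∧ E 0 = d ∧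
        (∀ t : ℝ, E t ∈ admissibleVacuumData X) ∧ (∀ t : ℝ, ∀ x ∈ e.far R₀, AgreeAt (E t) d x) ∧
        x₀ ∉ e.far R₀ ∧ Set.InjOn (fun t : ℝ ↦ (E t).h.inner x₀ v₀ v₀) (Set.Ioo (-1) 1) ∧
        ∀ S : ℝ × ℝ → InitialDataSet (𝓡 3) X,
          SmoothSectionsOn (𝓘(ℝ, ℝ).prod 𝓘(ℝ, ℝ)) S {p : (ℝ × ℝ) × X | Rstar < p.1.1} →
          (∀ R t : ℝ, Rstar < R →
            S (R, t) ∈ admissibleVacuumData X ∧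
            (∀ x ∉ e.far R, AgreeAt (S (R, t)) (E t) x) ∧
            (∀ x ∈ e.far R₀, AgreeAt (S (R, t)) (G R) x)) →
          ∃ ρ : ℝ → ℝ, ContinuousOn ρ {t : ℝ | t ≠ 0} ∧
            ∀ R t : ℝ, Rstar < R → ρ t ≤ R → t ≠ 0 → |t| < 1 → S (R, t) ∈ coreSet X

/-- READ-BACK CHECK: the first tree reduction (p117120) applied verbatim — `A → D′ → crux`. -/
theorem crux_of_surgery (hA : FarGluing) (hD : StableUnfoldingOneAtlas) : HonestFixedRadiusSettling :=
  honestFixedRadiusSettling_of_surgery hA hD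

/-- READ-BACK CHECK: the second tree reduction (p121008) applied verbatim — `A″ → D″ → crux`. -/
theorem crux_of_growing (hA : FarAnnulusGluingAt) (hD : StableUnfoldingGrowing) : HonestFixedRadiusSettling :=
  honestFixedRadiusSettling_of_farAnnulusGluing hA hD

/-- Any refutation of the crux refutes A or D′. -/
theorem not_A_or_not_D'_of_not_crux (hn : ¬ HonestFixedRadiusSettling) : ¬ FarGluing ∨ ¬ StableUnfoldingOneAtlas := by
  by_contra h
  push Not at h
  exact hn (crux_of_surgery h.1 h.2)

/-- Any refutation of the crux refutes A″ or D″. -/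
theorem not_A''_or_not_D''_of_not_crux (hn : ¬ HonestFixedRadiusSettling) :
    ¬ FarAnnulusGluingAt ∨ ¬ StableUnfoldingGrowing := by
  by_contra h
  push Not at h
  exact hn (crux_of_growing h.1 h.2)

/-! #### §9b The kill shape of D″: ONE poisoned growing far-gluing family (landed twin: p122095) -/

section Poison

variable {X : Type} [TopologicalSpace X] [ChartedSpace E3 X] [IsManifold (𝓡 3) ∞ X] [ConnectedSpace X]

/-- **A far-gluing family `(η, e, R⋆, m, G)` of `d` in the growing schedule is POISONED**: D″'s own hypotheses on
the family, and for EVERY `R₀ ∈ (e.R, R⋆)` and EVERY radius-indexed family `P` of admissible data agreeing with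
`G R` on `e.far R₀` (every re-filling of the interiors below `R₀`) the exceptional radii `{R > R⋆ | P R ∉ coreSet X}`
are unbounded.  PAPER WITNESS (vacuum; not constructible in the tree): `η < min(ε_o², μ_o)`; `G R :=` [`d` untouched
inside `R`] ⊕ [N-body gluing (Chruściel–Corvino–Isenberg 2011) of a unit-size member `Ψ_{λ(R)}`,
`λ(R) = λ_crit + sin R`, of a one-parameter family crossing a codimension-one exceptional wall — extremal critical
collapse, Kehle–Unger arXiv:2402.10190 Conj. 5 (vacuum) with the robustness of Conj. 3 ("any nearby interpolating
family also intersects `𝔅_crit`"), or the critical-collapse threshold — planted at chart radius `8R`] ⊕ [Mao–Oh–Tao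
Thm 1.7 at scale `R` (in-annulus `(10R, 11R)`, out-annulus `(20R, 22R)`, Rem 1.8) onto exact
Schwarzschild(`ηR + M`): (1.17)–(1.21) read `ΔE_resc ≈ η < ε_o²`, `‖out − δ‖² ≈ η² < μ_o η`,
`|ΔC| + |ΔJ| = o(R⁻¹) < μ_o η`; output `√η`-small in every rescaled `Hˢ` (Rem 1.9), so the glue shell DISPERSES
by exterior stability of Minkowski space]; smooth in `R` by the smooth-dependence atom every gluing line assumes.
A re-filling below `R₀` (quasi-local mass pinned near `M_ADM(d)` by agreement with `d` on `e.far R₀ ∖ e.far R`)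
perturbs the plant by radiation of fluence `O(R⁻²)` only, and the inward half of the glue shell washes over it as a
wave of length `≍ R` and amplitude `≍ √η` (tidal field `√η/R²`, absorption `O(R⁻ᵖ)`); so on every period of `sin R`
the perturbed family still crosses the wall, at a member whose domain of outer communication contains a hole
settling to an EXACTLY extremal Kerr — no honest decomposition (`Kerr.IsSubextremal` in `honestCoreSet`;
fixed-radius `C⁴` convergence pins the parameters) — or is naked (incomplete `𝓘⁺`, excluded by CERT):
`P R ∉ coreSet X` for unboundedly many `R`, whatever the interior.  MERGER GUARD: if the re-filled interior forms
black holes, a head-on merger with the plant would defuse extremality in finite time (`χ_f < 1` robustly); therefore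
the plant is given a slow ESCAPING boost `|v| = R^{-1/4} ≫ v_esc ≍ R^{-1/2}`, balanced by an oppositely boosted
counterweight (a second small body: admissible data have `P_ADM = 0`, `k = o(r⁻²)`), and recedes forever — final
state `N ≥ 2` with one exactly extremal, slowly boosted hole (the decomposition allows boosted holes, not extremal
ones). -/
def IsPoisonedGrowingFamily (d : InitialDataSet (𝓡 3) X) (η : ℝ) (e : AFEnd X) (Rstar : ℝ) (m : ℝ → ℝ)
    (G : ℝ → InitialDataSet (𝓡 3) X) : Prop :=
  0 < η ∧ e.IsSoleEnd ∧ e.R < Rstar ∧ ContDiff ℝ ∞ m ∧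
    SmoothSectionsOn 𝓘(ℝ, ℝ) G {p : ℝ × X | Rstar < p.1} ∧
    (∀ R : ℝ, Rstar < R → G R ∈ admissibleVacuumData X ∧ (∀ x ∉ e.far R, AgreeAt (G R) d x) ∧
      η * R ≤ m R ∧ IsExactSchwarzschildBeyond e (G R) (m R) (32 * R)) ∧
    ∀ R₀ : ℝ, e.R < R₀ → R₀ < Rstar → ∀ P : ℝ → InitialDataSet (𝓡 3) X,
      (∀ R : ℝ, Rstar < R → P R ∈ admissibleVacuumData X ∧ ∀ x ∈ e.far R₀, AgreeAt (P R) (G R) x) →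
        ∀ R₁ : ℝ, ∃ R : ℝ, R₁ ≤ R ∧ Rstar < R ∧ P R ∉ coreSet X

/-- **THE KILL SHAPE OF D″.** One poisoned growing far-gluing family at one admissible datum refutes
`StableUnfoldingGrowing`: D″'s probe and the LANDED patching engine `stub_probePatch` (p116096) produce the patched
surgery `S`; D″'s threshold puts `S (R, 1/2)` in `coreSet X` for `R ≥ ρ (1/2)`; the poison applied to the re-filling
`P R := S (R, 1/2)` gives an exceptional `R ≥ ρ (1/2)`.  With §9a: `FarAnnulusGluingAt ∧ StableUnfoldingGrowing`
is false on paper; 15427's atom cannot serve this line. -/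
theorem stableUnfoldingGrowing_false_of_poison [T2Space X] [SecondCountableTopology X]
    {d : InitialDataSet (𝓡 3) X} (hd : d ∈ admissibleVacuumData X) {η : ℝ} {e : AFEnd X} {Rstar : ℝ}
    {m : ℝ → ℝ} {G : ℝ → InitialDataSet (𝓡 3) X} (hP : IsPoisonedGrowingFamily d η e Rstar m G) :
    ¬ StableUnfoldingGrowing := by
  intro hD
  obtain ⟨hη, hsole, heR, hm, hGsmooth, hGmem, hpoison⟩ := hP
  obtain ⟨R₀, E, x₀, v₀, hR₀, hR₀star, hEsmooth, -, hEadm, hEd, -, -, hrob⟩ :=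
    hD X d hd η e Rstar m G hη hsole heR hm hGsmooth hGmem
  obtain ⟨S, hSsmooth, hS⟩ := stub_probePatch X d e R₀ Rstar E G hsole hR₀ hR₀star hEsmooth hEadm hEd
    hGsmooth fun R hR ↦ ⟨(hGmem R hR).1, (hGmem R hR).2.1⟩
  obtain ⟨ρ, -, hgood⟩ := hrob S hSsmooth hS
  obtain ⟨R, hρR, hR, hbad⟩ := hpoison R₀ hR₀ hR₀star (fun R ↦ S (R, 1 / 2))
    (fun R hR ↦ ⟨(hS R (1 / 2) hR).1, (hS R (1 / 2) hR).2.2⟩) (ρ (1 / 2))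
  exact hbad (hgood R (1 / 2) hR hρR (by norm_num) (by rw [abs_of_pos (by norm_num)]; norm_num))

/-- **D″ as a CURE principle**: every growing far-gluing family of every admissible datum is cured beyond some
radius by ONE fixed admissible re-filling `D₁ = E (1/2)` of the interior (`P R = S (R, 1/2)`): the statement the
poison refutes on paper. -/
theorem cure_of_stableUnfoldingGrowing (hD : StableUnfoldingGrowing) [T2Space X] [SecondCountableTopology X]
    {d : InitialDataSet (𝓡 3) X} (hd : d ∈ admissibleVacuumData X) {η : ℝ} {e : AFEnd X} {Rstar : ℝ}
    {m : ℝ → ℝ} {G : ℝ → InitialDataSet (𝓡 3) X} (hη : 0 < η) (hsole : e.IsSoleEnd) (heR : e.R < Rstar)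
    (hm : ContDiff ℝ ∞ m) (hGsmooth : SmoothSectionsOn 𝓘(ℝ, ℝ) G {p : ℝ × X | Rstar < p.1})
    (hGmem : ∀ R : ℝ, Rstar < R → G R ∈ admissibleVacuumData X ∧ (∀ x ∉ e.far R, AgreeAt (G R) d x) ∧
      η * R ≤ m R ∧ IsExactSchwarzschildBeyond e (G R) (m R) (32 * R)) :
    ∃ (R₀ : ℝ) (D₁ : InitialDataSet (𝓡 3) X) (P : ℝ → InitialDataSet (𝓡 3) X) (R₁ : ℝ),
      e.R < R₀ ∧ R₀ < Rstar ∧ D₁ ∈ admissibleVacuumData X ∧ (∀ x ∈ e.far R₀, AgreeAt D₁ d x) ∧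
      (∀ R : ℝ, Rstar < R → P R ∈ admissibleVacuumData X ∧ (∀ x ∉ e.far R, AgreeAt (P R) D₁ x) ∧
        (∀ x ∈ e.far R₀, AgreeAt (P R) (G R) x)) ∧
      ∀ R : ℝ, R₁ ≤ R → Rstar < R → P R ∈ coreSet X := by
  obtain ⟨R₀, E, x₀, v₀, hR₀, hR₀star, hEsmooth, -, hEadm, hEd, -, -, hrob⟩ :=
    hD X d hd η e Rstar m G hη hsole heR hm hGsmooth hGmem
  obtain ⟨S, hSsmooth, hS⟩ := stub_probePatch X d e R₀ Rstar E G hsole hR₀ hR₀star hEsmooth hEadm hEd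
    hGsmooth fun R hR ↦ ⟨(hGmem R hR).1, (hGmem R hR).2.1⟩
  obtain ⟨ρ, -, hgood⟩ := hrob S hSsmooth hS
  refine ⟨R₀, E (1 / 2), fun R ↦ S (R, 1 / 2), ρ (1 / 2), hR₀, hR₀star, hEadm _, hEd _,
    fun R hR ↦ ⟨(hS R _ hR).1, (hS R _ hR).2.1, (hS R _ hR).2.2⟩, fun R hρR hR ↦ ?_⟩
  exact hgood R (1 / 2) hR hρR (by norm_num) (by rw [abs_of_pos (by norm_num)]; norm_num)

/-- `StableUnfoldingGrowing` restricted to the deep-burial regime `64 < η` (D″ with one extra hypothesis). -/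
def StableUnfoldingGrowing64 : Prop :=
  ∀ (X : Type) [TopologicalSpace X] [ChartedSpace E3 X] [IsManifold (𝓡 3) ∞ X] [T2Space X]
    [SecondCountableTopology X] [ConnectedSpace X], ∀ d ∈ admissibleVacuumData X,
    ∀ (η : ℝ) (e : AFEnd X) (Rstar : ℝ) (m : ℝ → ℝ) (G : ℝ → InitialDataSet (𝓡 3) X),
      64 < η → 0 < η → e.IsSoleEnd → e.R < Rstar → ContDiff ℝ ∞ m →
      SmoothSectionsOn 𝓘(ℝ, ℝ) G {p : ℝ × X | Rstar < p.1} →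
      (∀ R : ℝ, Rstar < R → G R ∈ admissibleVacuumData X ∧ (∀ x ∉ e.far R, AgreeAt (G R) d x) ∧
        η * R ≤ m R ∧ IsExactSchwarzschildBeyond e (G R) (m R) (32 * R)) →
      ∃ (R₀ : ℝ) (E : ℝ → InitialDataSet (𝓡 3) X) (x₀ : X) (v₀ : TangentSpace (𝓡 3) x₀),
        e.R < R₀ ∧ R₀ < Rstar ∧ SmoothSectionsOn 𝓘(ℝ, ℝ) E (Set.univ : Set (ℝ × X)) ∧ E 0 = d ∧
        (∀ t : ℝ, E t ∈ admissibleVacuumData X) ∧ (∀ t : ℝ, ∀ x ∈ e.far R₀, AgreeAt (E t) d x) ∧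
        x₀ ∉ e.far R₀ ∧ Set.InjOn (fun t : ℝ ↦ (E t).h.inner x₀ v₀ v₀) (Set.Ioo (-1) 1) ∧
        ∀ S : ℝ × ℝ → InitialDataSet (𝓡 3) X,
          SmoothSectionsOn (𝓘(ℝ, ℝ).prod 𝓘(ℝ, ℝ)) S {p : (ℝ × ℝ) × X | Rstar < p.1.1} →
          (∀ R t : ℝ, Rstar < R →
            S (R, t) ∈ admissibleVacuumData X ∧
            (∀ x ∉ e.far R, AgreeAt (S (R, t)) (E t) x) ∧
            (∀ x ∈ e.far R₀, AgreeAt (S (R, t)) (G R) x)) →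
          ∃ ρ : ℝ → ℝ, ContinuousOn ρ {t : ℝ | t ≠ 0} ∧
            ∀ R t : ℝ, Rstar < R → ρ t ≤ R → t ≠ 0 → |t| < 1 → S (R, t) ∈ coreSet X

/-- BURIAL (data-level; the honest-`C⁴`/one-atlas form of SwallowTheDatum's `SheetShieldedSettles`, stmt-15428, and of
the crux cards bury-it-honestly / inherit-the-burial-exact-kerr-honesty): every admissible datum exactly time-symmetric
isotropic Schwarzschild(`M`) beyond a chart radius `ϱ < M / 2` — i.e. from inside the throat `‖x‖ = M/2`, a minimal
sphere with `k = 0` enclosing trapped spheres, outward — lies in `coreSet X`.  True on paper (the domain of outer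
communication of any development is `D⁺`(exterior sheet) = Kruskal region I), modulo MGHD existence. -/
def Burial : Prop :=
  ∀ (X : Type) [TopologicalSpace X] [ChartedSpace E3 X] [IsManifold (𝓡 3) ∞ X] [T2Space X]
    [SecondCountableTopology X] [ConnectedSpace X], ∀ D ∈ admissibleVacuumData X,
    ∀ (e : AFEnd X) (M ϱ : ℝ), ϱ < M / 2 → IsExactSchwarzschildBeyond e D M ϱ → D ∈ coreSet X

/-- **THE DEEP-BURIAL REGIME OF D″ IS BURIAL** (landed twin: `Negative/StableUnfoldingGrowingBurial.lean`, p122410):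
`Burial → StableUnfoldingGrowing64`, with the CONSTANT threshold `ρ ≡ 0` and the LANDED breathing probe
(`exists_breathingProbe`, p-landed 19:02Z) — unfolding, marker and threshold IDLE: `m R ≥ ηR > 64R` gives
`32R < m R / 2`, and `S (R, t) = G R` on `e.far R₀ ⊇ {32R < ‖x‖}` is exactly Schwarzschild(`m R`) there.  With
`stableUnfoldingGrowing_false_of_poison`: NO regime of the growing schedule carries this line's own mechanism. -/
theorem stableUnfoldingGrowing64_of_burial (hburial : Burial) : StableUnfoldingGrowing64 := by
  intro X _ _ _ _ _ _ d hd η e Rstar m G h64 _ _ heR _ _ hGmem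
  set R₀ : ℝ := (e.R + Rstar) / 2 with hR₀_def
  have hR₀ : e.R < R₀ := by rw [hR₀_def]; linarith
  have hR₀s : R₀ < Rstar := by rw [hR₀_def]; linarith
  obtain ⟨E, x₀, v₀, hEs, hE0, hEadm, hEd, hx₀, hmark⟩ := exists_breathingProbe X d e R₀ hd hR₀
  refine ⟨R₀, E, x₀, v₀, hR₀, hR₀s, hEs, hE0, hEadm, hEd, hx₀, hmark, fun S _ hS ↦ ?_⟩
  refine ⟨fun _ ↦ 0, continuousOn_const, fun R t hR _ _ _ ↦ ?_⟩
  obtain ⟨hadm, -, hSG⟩ := hS R t hR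
  obtain ⟨-, -, hmass, hexact⟩ := hGmem R hR
  have hRpos : 0 < R := e.R_pos.trans (hR₀.trans (hR₀s.trans hR))
  refine hburial X (S (R, t)) hadm e (m R) (32 * R) ?_ fun x hx ↦ ?_
  · nlinarith
  · have hx' : R₀ < ‖x‖ := by nlinarith [hR₀s.trans hR]
    obtain ⟨hh, hk⟩ := hCoeff_kCoeff_congr_of_agree_far e hR₀ hSG hx'
    rw [hh, hk]
    exact hexact x hx

/-- D″ implies its deep-burial restriction (trivially), so the dichotomy is exhaustive in `η` up to the
intermediate band `η ∈ [ε, 64]`, where the adversary takes `m R = ηR` and the exact zone starts at areal radius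
`32R (1 + η/64)² ≥ 2ηR` (equality iff `η = 64`): no clean statement either way (§9d.1). -/
theorem stableUnfoldingGrowing64_of_stableUnfoldingGrowing (h : StableUnfoldingGrowing) : StableUnfoldingGrowing64 :=
  fun X _ _ _ _ _ _ d hd η e Rstar m G _ hη hsole heR hm hGs hGmem ↦ h X d hd η e Rstar m G hη hsole heR hm hGs hGmem

/-! #### §9c The same kill shape for D′ — expected EMPTY (`sobDev`-smallness is subcritical) -/

/-- **`d` is POISONED FOR REMOTE SURGERY**: over every sole DR end, mass parameter, radius and interior probe through
`d`, some `IsRemoteSurgery` (shrinking schedule `m R → M₀` WITH `sobDev → 0` uniformly on every dyadic annulus beyond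
`R`) has a fixed `0 < |t| < 1` with unbounded exceptional radii.  PAPER VERDICT: expected UNSATISFIABLE — a plant of
mass `μ` concentrated at scale `ρ₀` in `A_λ`, `λ ≥ R`, costs `λ ∫_{A_λ} |∂² δh|² ≳ R μ² / ρ₀³` (`≳ R / μ → ∞` at collapse
compactness `ρ₀ ≲ μ`); a focusing pulse of width `δ₀` and energy `μ` costs `≳ R μ / δ₀²`, forcing
`δ₀ ≫ √(R μ) ≫ μ` — no short pulse (Christodoulou 2009, Thm 17.1), no trapped surface inside the Cauchy-stable
window (bounded-`L²`-curvature); so no black-hole threshold and no extremality wall fits inside a remote surgery,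
whose far content perturbs the interior's settled sub-extremal holes only by absorbed energy `≤ m R − M₀ → 0` and
angular momentum `≲ (m R − M₀) Mᵢ → 0`, inside the threshold `ρ t`.  The `sobDev` clause of `IsRemoteSurgery` is
thus LOAD-BEARING for D′: delete it (pass to the growing schedule) and §9b's poison applies. -/
def IsPoisonedForRemoteSurgery (d : InitialDataSet (𝓡 3) X) : Prop :=
  ∀ (e : AFEnd X) (M₀ R₀ : ℝ) (E : ℝ → InitialDataSet (𝓡 3) X),
    e.IsSoleEnd → e.IsStronglyAsymptoticallyFlatDR d M₀ → IsInteriorProbe d e R₀ E →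
      ∃ (Rstar : ℝ) (m : ℝ → ℝ) (S : ℝ × ℝ → InitialDataSet (𝓡 3) X),
        IsRemoteSurgery d e M₀ R₀ E Rstar m S ∧
          ∃ t : ℝ, t ≠ 0 ∧ |t| < 1 ∧ ∀ R₁ : ℝ, ∃ R : ℝ, R₁ ≤ R ∧ Rstar < R ∧ S (R, t) ∉ coreSet X

/-- **THE KILL SHAPE OF D′** (pure logic): one admissible datum poisoned for remote surgery refutes
`StableUnfoldingOneAtlas`.  What a refutation of the first reduction's core must produce; none is expected (§9c). -/
theorem stableUnfoldingOneAtlas_false_of_poison [T2Space X] [SecondCountableTopology X]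
    {d : InitialDataSet (𝓡 3) X} (hd : d ∈ admissibleVacuumData X) (hP : IsPoisonedForRemoteSurgery d) :
    ¬ StableUnfoldingOneAtlas := by
  intro hD
  obtain ⟨e, M₀, R₀, E, x₀, v₀, hsole, hSAF, hprobe, -, -, hrob⟩ := hD X d hd
  obtain ⟨Rstar, m, S, hS, t, ht, ht1, hbad⟩ := hP e M₀ R₀ E hsole hSAF hprobe
  obtain ⟨ρ, -, hgood⟩ := hrob Rstar m S hS
  obtain ⟨R, hρR, hR, hRbad⟩ := hbad (ρ t)
  exact hRbad (hgood R t hR hρR ht ht1)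

end Poison

/-! #### §9d Paper findings of generation 4 (documentation)

1. THE η-DICHOTOMY OF D″ (why no repair inside 15427's output class). D″ is `∀ η > 0`. For `η` small the family is
   poisonable (§9b). For `η > 64`, `m R ≥ ηR` puts the isotropic throat `‖x‖ = m R / 2 > 32R` INSIDE the exact zone:
   a minimal sphere with `k = 0` (marginally trapped), trapped spheres just inside it; the datum, the probe and the
   whole annulus lie below; the domain of outer communication of every development is `D⁺`(exterior sheet) = Kruskal
   region I exactly (its boundary is the outgoing null hypersurface from the throat, crossed by causal curves only
   inward), whatever the interior does — every member is good for the reason of SwallowTheDatum's burial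
   (`SheetShieldedSettles`, 15428; card bury-it-honestly), with probe, marker and threshold junction idle. A D″
   restricted to `η > 64` is the burial line in disguise. Intermediate `η`: the adversary takes `m R = ηR`; the exact
   zone starts at areal radius `32R(1 + η/64)² ≥ 2ηR` with equality iff `η = 64`; no clean statement either way.
   RECOMMENDATION to the lead: drop D″ / p121008 from the skeleton; the core of this line is D′, whose far-gluing
   partner A uses the shrinking schedule with `sobDev → 0` and is NOT 15427's atom.
2. A AGAINST THE PRINT (Mao–Oh–Tao arXiv:2308.13031, Thm 1.7, p. 6, materialised). Hypotheses at scale `R` with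
   `θ_R := m R − M₀ ↓ 0`: `ΔE > |ΔP|` (`θ_R > 0 = |ΔP|`, DR class has `P = 0`); `ΔE < ε_o²` (`θ_R/R`);
   `|ΔC| + |ΔJ| < μ_o ΔE` (rescaled `o(R⁻¹) < μ_o θ_R/R`, i.e. `θ_R ≫ o(1)`); `‖in − δ‖² + ‖out − δ‖² < μ_o ΔE`
   (`O(M₀²/R²) + o(R⁻²) < μ_o θ_R/R`, i.e. `θ_R ≫ M₀²/R`) — all met by a slowly decaying `θ_R`; conclusion (1.22)
   gives `sobDev ≤ C_o θ_R/R + (own DR decay) → 0`; persistence of regularity (Rem 1.9) gives `C^∞` members; the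
   ONLY unprinted atom is `C^∞`-dependence on `R` (Rem 1.9 prints local Lipschitz continuity). Remark: `sobDev → 0`
   is blind to a FIXED mass offset (`λ⁻³ ∫_{A_λ} |2ΔM/r|² ≍ (ΔM)²/λ² → 0`), so `IsFarGluingFamily d e M₀ …` is
   satisfiable on paper for every `M₀ ≥ M_ADM(d)` (gap `ΔE = M₀ − M_ADM + θ_R > 0`) and unsatisfiable for
   `M₀ < M_ADM(d)` (negative gap; quasi-local mass monotonicity) — harmless: A carries the hypothesis
   `e.IsStronglyAsymptoticallyFlatDR d M₀`, which pins `M₀ = M_ADM(d)`, and the mass convergence of a remote surgery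
   is carried by `Tendsto m atTop (𝓝 M₀)` alone.
3. THE ONE-ATLAS CLAUSES ON SCHWARZSCHILD-ENDED MEMBERS (the lead's `disprover-wanted`). In the exact region of the
   MGHD of a member (outside the outgoing null cone `𝒩` from the sphere `‖x‖_iso = 32R′` of `Σ`), the flat chart of
   an honest decomposition can be taken to be the `(t_Schw, x_areal)` chart (= `blToKS`-pulled Kerr with `a = 0`,
   `M = m R′ > 0`): EXACT on the zone `{|y| > Rs(y⁰)}` with `Rs(t) := r_𝒩(t)` for `t ≥ 0` (areal radius of `𝒩`,
   `Rs' = 1 − 2M/Rs ∈ (0, 1)`, so the slope clause `≤ 2` and `Rs ≥ 16M + 1` hold for `R′` large) and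
   `Rs(t) := Rs(0) + |t|` for `t ∈ (−1, 0)` (the slope clause only binds `t ≥ 0`; the two-sided MGHD contains the
   past zone); ATTACHED with `φ :=` end chart ∘ (areal → isotropic radius), an open embedding of `{‖x‖ > r₁}` with
   co-compact far images; COVER with `Bs :=` the closed coordinate ball of radius `32R′ + 1` (compact by the sole
   end): a point `(t₁, y)` with `|y| ≤ Rs(t₁)` lies on or inside `𝒩`, i.e. in `J⁺` of the closed ball bounded by the
   sphere, because Schwarzschild is static with radial null speeds `±(1 − 2M/r)` — the past-ingoing ray from
   `(t₁, r_𝒩(t₁))` retraces `𝒩` to the sphere; `J⁺(Σ) = J⁺(ball) ∪ D⁺(Σ ∖ ball)` in any globally hyperbolic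
   development; ORIENTED/INJECTIVE are properties of the static chart; SEPARATED holds since all tubes stay at radius
   `O(R′) ≪ Rs − κ t` for small `κ`; `0 ≤ M`, `|a| ≤ M` with `a = 0`, `M = m R′ > M₀ ≥ 0` (positive mass theorem on
   paper; in the tree `M₀ < m R′` is a clause and `0 ≤ M₀` is not needed since `M = m R′` must only be `≥ 0`, which
   fails only if `m R′ < 0`, i.e. never once `M₀ ≥ 0`; for a hypothetical admissible `d` with `M₀ < 0` the clause
   `0 ≤ M` WOULD bite at `R′` with `m R′ < 0` — vacuous by PMT). Hence NO TYPED OBSTRUCTION in the seventeen clauses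
   for Schwarzschild-ended members; a Lean consistency witness at `M > 0` needs the Schwarzschild MGHD (absent), the
   `M = 0` witness is §8d.
4. LOAD-BEARING TABLE OF D′ (paper). `t ≠ 0`: load-bearing (the `t = 0` member is the far-surgered `d`, exceptional
   whenever `d` is — the interior is untouched). `|t| < 1`: normalisation (reparametrise the probe by `tanh`), not
   load-bearing. `ContinuousOn ρ {t ≠ 0}` rather than on `ℝ`: load-bearing (a threshold bounded near `t = 0` is false
   at exceptional `d`, the margin degenerates). `Tendsto m atTop (𝓝 M₀)`: physically harmless either way (a fixed far
   mass gap at scale `R → ∞` couples to holes of size `Mᵢ` only at order `(Mᵢ/R)^k`). The `∀ S` quantifier: sound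
   BECAUSE of `sobDev` (§9c). The probe clause is inhabited (lead's `exists_breathingProbe`, registered 18:56Z).
5. LINE STATUS (gen 4). Registered skeleton `4a983fe8fc73`: A open (literature-grade atom), D′ open (the core),
   D″ refuted on paper (evidence `StableUnfoldingGrowing.md`, "stub-misstated", 19:16Z; kernel shape p122095).
   NO KILL of the crux.
-/

end Surgery

/-! ### §5 Near-misses and why the crux resists (documentation; see the module docstring)

No false theorem is stated anywhere in this file: every candidate counterexample to the crux or to the leaf
needs an MGHD of an admissible datum at which the clauses fail, and the tree constructs no maximal
development (not even Minkowski's maximality, the Choquet-Bruhat–Geroch fact). The paper analysis of each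
clause on exact Kerr / two receding holes (gen 1), of `stub_core` (gen 2) and of the admissible class, Kerr
ends, gluing and sub-developments (gen 3, §8e) is in the docstrings and in the seats' NOTES.md. -/

end Summit.FinalStateConjecture.FinalStateConjecture.Cruxes.HonestFixedRadiusSettling.Disproof

end
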